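import Literature.NumberTheory.LFunctions.Zhang2022.Section9Statements
import Literature.NumberTheory.LFunctions.Zhang2022.Section10Theta1Evals
import HarnessLib

/-!
# Zhang (2022) §9 «Evaluation of Ξ₁₂»: kernel discharges along the proof node `Ded97`

Y. Zhang, *Discrete mean estimates and the Landau–Siegel zero*, arXiv:2211.02515v1 (2022)
[Zhang2022LandauSiegel] — **an unrefereed manuscript under adjudication; this file asserts nothing about
its Theorems 1–2 or about Landau–Siegel zeros.** Campaign cell `siegel-zhang` (D-0069), discharge seat
d17, work-list row D03 = cone leaf C23: the banked proof node
`Skeleton.Ded97 c' : Eq91 c' → Prop71 c' → Lemma82 c' → Lemma83 c' → Lemma84 c' → Eval97 c'`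
(SkeletonPartTwo), refined statement by statement in `Section9Statements` (slice L2-t10; DAG nodes
`Z22:(9.1)` … `Z22:(9.8)` of Zhang §9, PDF pp. 51–52, tex L2586–L2689).

What is PROVED here (theorem-only; 0 new definitions, 0 new facts):

| node (DAG id) | decl | content |
|---|---|---|
| `Z22:(9.7)` inference | `ded97last_holds : Ded97last c'`, `ded97lastc_holds : Ded97lastc c'` | (9.1) + `Θ₁(𝐚₁₂,𝐚₂₂) = B𝔞𝔓 + o(𝔓)` ⇒ (9.7), both prefactor readings (`frakc2 = coeff97 + conj coeff97`, resp. the tree's `frakc2c_eq_coeff_add_conj`) |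
| `Z22:§9.u007` inference | `step9u007c_of : Prop71 → Step9u005 → Step9u006c → Step9u007c` (and `step9u007_of`, printed reading) | "It follows by Proposition 7.1": INCLUDING the implicit `E(𝐚₁₂,𝐚₂₂) = 𝔓𝓛²Σ\|S_j\| = o(𝔓)`, closed here from the per-`j` integral form `Z22:§9.u005`, `‖int9cov_j‖ ≪ 𝓛⁻⁹` (`exists_norm_int9cov_le`) and `𝔞 ≤ 360000𝓛⁴` (`frakA_le_log_pow_four`, Cauchy's bound on `L′(1,χ)` from `Section3Lemma31`) |
| `Z22:§9.u005` inference | `ded9u005_holds : Ded9u005 c'` | the change of variables `x → P₂/x`, `x → P₃/x`: the two displayed forms are the tree's `S811g`/`S812g` at scales `(P₂,P₃)` (`int9main_add_tail_eq_S811g`, `int9cov_eq_S812g`, `P2_div_P3`), so `S811g_eq_S812g` applies verbatim |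
| `Z22:§9.u002` inference | `ded9u002_holds : Ded9u002 c'` | Lemma 8.2 at `x = P₃/(dr)`, `μ = 6` (summand identity `vk3_summand_eq`, truncation at `m < x`) |
| `Z22:§9.u003` inference | `ded9u003_holds : Ded9u003 c'` | Lemma 8.4 at `x = P₃/(dr)`, `μ = 6` (`conj(q^{β₆}) = q^{−β₆}`, `conj_vk3_summand_eq`) |

Consequently the c-reading chain `Eq91 → Prop71 → Lemma82 → Lemma84 → Eval97c` is kernel-closed MODULO
exactly two typed steps: `Ded9u004` ("in a way similar to the proof of (8.12)": the (8.10)/[T, 1.2.12]/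
partial-summation passage, shared with §8) and `Ded9u006c` (the substitution `x = Pᶻ` at the actual
shifts). The typed `Ded9u007 : Prop71 → Step9u006 → Step9u007` is proved here in the (stronger-hypothesis)
form with `Step9u005` added — the weighted sum alone does not control `E(𝐚₁₂,𝐚₂₂)`; see the cell's
GAP-LEDGER note of seat d17. Helper estimates (sizes of `α, β_j, β_μ, 𝔣_{jμ}, 𝔤_{jμ}, log P₂, log P₃`)
are stated with explicit constants depending only on `c′`.

## References

* Y. Zhang, arXiv:2211.02515v1 (2022), §9 pp. 51–52; §7 Prop. 7.1 p. 33; §8 Lemmas 8.2, 8.4 pp. 45–46,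
  (8.6) p. 44, (8.11)–(8.12) p. 48; §2 (2.6), (2.10), (2.13), (2.21), (2.22), (2.31).
  [cite: Zhang2022LandauSiegel, §9]
-/

/-! # Discharges (seat d17) -/

noncomputable section

open Complex Real ComplexConjugate

namespace Literature.NumberTheory.LFunctions.Zhang2022.Section9Discharge

open Skeleton Section9Statements

/-! ## The last step: (9.1) + `Θ₁(𝐚₁₂,𝐚₂₂) = B𝔞𝔓 + o(𝔓)` ⇒ (9.7) -/

/-- Real part of `B · 𝔞 · 𝔓` for real `𝔞, 𝔓`. [folklore] -/
private theorem re_mul_ofReal_mul_ofReal (B : ℂ) (a p : ℝ) :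
    (B * (a : ℂ) * (p : ℂ)).re = B.re * a * p := by
  simp [Complex.mul_re, Complex.ofReal_re, Complex.ofReal_im]

/-- The algebra of the last step of §9 (and of §8): if `|Ξ − 2Re Θ| ≤ e₁` and `‖Θ − B𝔞𝔓‖ ≤ e₂` then
`|Ξ − Re(B + B̄)·𝔞𝔓| ≤ e₁ + 2e₂`. [cite: Zhang2022LandauSiegel, §9 (9.7) p.52, tex L2646–L2669] -/
private theorem abs_sub_coeff_le {Ξ a p e₁ e₂ : ℝ} {Θ B : ℂ} (h1 : |Ξ - 2 * Θ.re| ≤ e₁)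
    (h2 : ‖Θ - B * (a : ℂ) * (p : ℂ)‖ ≤ e₂) :
    |Ξ - (B + conj B).re * a * p| ≤ e₁ + 2 * e₂ := by
  have hre : (B + conj B).re = 2 * B.re := by
    rw [Complex.add_re, Complex.conj_re]; ring
  have h3 : |(Θ - B * (a : ℂ) * (p : ℂ)).re| ≤ e₂ :=
    (Complex.abs_re_le_norm _).trans h2
  rw [Complex.sub_re, re_mul_ofReal_mul_ofReal] at h3
  rw [hre]
  calc |Ξ - 2 * B.re * a * p|
      = |(Ξ - 2 * Θ.re) + 2 * (Θ.re - B.re * a * p)| := by ring_nf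
    _ ≤ |Ξ - 2 * Θ.re| + |2 * (Θ.re - B.re * a * p)| := abs_add_le _ _
    _ = |Ξ - 2 * Θ.re| + 2 * |Θ.re - B.re * a * p| := by
        rw [abs_mul, abs_of_pos (by norm_num : (0:ℝ) < 2)]
    _ ≤ e₁ + 2 * e₂ := by linarith

/-- **`Z22:(9.7)` INFERENCE, second reading, DISCHARGED**: `Skeleton.Eq91 c' → Step9u007c c' → Eval97c c'`
("This yields (9.7)": (9.1) `Ξ₁₂ = 2Re Θ₁(𝐚₁₂,𝐚₂₂) + o(𝔓)` and `Θ₁(𝐚₁₂,𝐚₂₂) = B₂𝔞𝔓 + o(𝔓)` with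
`B₂ = Theta1Coeff9`, so `Ξ₁₂ = (B₂ + B̄₂)𝔞𝔓 + o(𝔓) = 𝔠₂ᶜ𝔞𝔓 + o(𝔓)` by `frakc2c_eq_coeff_add_conj`).
[cite: Zhang2022LandauSiegel, §9 (9.7) p.52, tex L2646–L2669] -/
theorem ded97lastc_holds (c' : ℝ) : Ded97lastc c' := by
  intro h91 h007 ε hε
  have h1 := h91 (ε / 3) (by positivity)
  have h2 := h007 (ε / 3) (by positivity)
  refine (h1.and h2).mono ?_
  intro D _ χ _ _ h hA
  have e1 := h.1 hA
  have e2 := h.2 hA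
  have key := abs_sub_coeff_le e1 e2
  rw [← frakc2c_eq_coeff_add_conj] at key
  linarith

variable (c' : ℝ) in
/-- `Ded97lastc` — `_holds` alias of `ded97lastc_holds` above under the fact's exact name, stated under the
prover's own binders as section variables (appended 2026-08-28, D-0026 bookkeeping: the proof term is the
existing theorem of this file; no statement, definition or attribute is edited; no new named fact; the
ledger's debt table listed the fact unproved). [cite: Zhang2022LandauSiegel, §9 (9.7) p.52, tex L2646–L2669] -/
theorem _root_.Literature.NumberTheory.LFunctions.Zhang2022.Section9Statements.Ded97lastc_holds :
    _root_.Literature.NumberTheory.LFunctions.Zhang2022.Section9Statements.Ded97lastc c' :=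
  _root_.Literature.NumberTheory.LFunctions.Zhang2022.Section9Discharge.ded97lastc_holds (c' := c')

/-- `frakc2 = coeff97 + conj coeff97` (the printed-prefactor reading of `𝔠₂`, `Z22:§9.u008–u012`:
`c₃₃ = b₃₃ + b̄₃₃`, `c₄₄ = c₂₂ = b₂₂ + b̄₂₂ = b₄₄ + b̄₄₄`, `c₃₄ = b₃₄ + b̄₄₃`, `c₄₃ = c̄₃₄`) — pure algebra.
[cite: Zhang2022LandauSiegel, §9 p.52, tex L2654–L2668] -/
theorem frakc2_eq_coeff97_add_conj : frakc2 = coeff97 + conj coeff97 := by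
  unfold frakc2 coeff97 c43
  unfold c34 c33 c44 c22 b44
  simp only [map_add, map_mul, Complex.conj_conj, Complex.conj_ofReal]
  ring

/-- **`Z22:(9.7)` INFERENCE, printed reading, DISCHARGED**: `Skeleton.Eq91 c' → Step9u007 c' → Skeleton.Eval97 c'`
(same algebra with `coeff97` and the banked printed-prefactor `frakc2`).
[cite: Zhang2022LandauSiegel, §9 (9.7) p.52, tex L2646–L2669] -/
theorem ded97last_holds (c' : ℝ) : Ded97last c' := by
  intro h91 h007 ε hε
  have h1 := h91 (ε / 3) (by positivity)
  have h2 := h007 (ε / 3) (by positivity)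
  refine (h1.and h2).mono ?_
  intro D _ χ _ _ h hA
  have e1 := h.1 hA
  have e2 := h.2 hA
  have key := abs_sub_coeff_le e1 e2
  rw [← frakc2_eq_coeff97_add_conj] at key
  linarith

variable (c' : ℝ) in
/-- `Ded97last` — `_holds` alias of `ded97last_holds` above under the fact's exact name, stated under the
prover's own binders as section variables (appended 2026-08-28, D-0026 bookkeeping: the proof term is the
existing theorem of this file; no statement, definition or attribute is edited; no new named fact; the
ledger's debt table listed the fact unproved). [cite: Zhang2022LandauSiegel, §9 (9.7) p.52, tex L2646–L2669] -/
theorem _root_.Literature.NumberTheory.LFunctions.Zhang2022.Section9Statements.Ded97last_holds :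
    _root_.Literature.NumberTheory.LFunctions.Zhang2022.Section9Statements.Ded97last c' :=
  _root_.Literature.NumberTheory.LFunctions.Zhang2022.Section9Discharge.ded97last_holds (c' := c')

/-! ## The size of `𝔞` (2.31): `0 ≤ 𝔞 ≤ C𝓛⁴` -/

/-- **`𝔞 ≤ 360000𝓛⁴`** for `χ` primitive mod `D` with `𝓛 = log D ≥ 3` — a numerically lazier form of
the tree's `Skeleton.frakA_le_ell_pow_four` (`𝔞 ≤ (96e⁹/π²)𝓛⁴`, from Cauchy's bound on `L′(1,χ)`), using
`e < 3`, `π² > 9`. The manuscript uses `𝔞 ≪ 𝓛⁴` silently whenever `O(E(𝐚₁,𝐚₂)) = O(𝔞𝔓𝓛⁻⁷)` is absorbed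
into `o(𝔓)` (§§8–10). [cite: Zhang2022LandauSiegel, §2 (2.31) p.9, tex L622; §9 p.52, tex L2646] -/
theorem frakA_le_log_pow_four {D : ℕ} [NeZero D] (χ : DirichletCharacter ℂ D)
    (hL : 3 ≤ Real.log D) (hp : χ.IsPrimitive) :
    frakA χ ≤ 360000 * Real.log D ^ 4 := by
  have h := Skeleton.frakA_le_ell_pow_four χ (by rw [ell]; exact hL) hp
  rw [ell] at h
  refine h.trans (mul_le_mul_of_nonneg_right ?_ (by positivity))
  have he : Real.exp 9 < 19683 := by
    have h9 : Real.exp 9 = Real.exp 1 ^ 9 := by rw [← Real.exp_nat_mul]; norm_num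
    rw [h9]
    have h3 : Real.exp 1 < 3 := lt_trans Real.exp_one_lt_d9 (by norm_num)
    calc Real.exp 1 ^ 9 < 3 ^ 9 := pow_lt_pow_left₀ h3 (Real.exp_pos 1).le (by norm_num)
      _ = 19683 := by norm_num
  have hπ : 9 < π ^ 2 := by nlinarith [Real.pi_gt_three]
  rw [div_le_iff₀ (by positivity)]
  nlinarith

/-! ## Sizes of the parameters and of the profiles `𝔣_{jμ}, 𝔤_{jμ}` -/

section Sizes

variable (c' : ℝ) {D : ℕ}

/-- Eventually (in `D`) `log D ≥ L₀`, in the `ForAllLarge` format ("`D` greater than a sufficiently large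
and effectively computable number"). [cite: Zhang2022LandauSiegel, §2 p.4] -/
private theorem forAllLarge_log_ge (L₀ : ℝ) : ForAllLarge fun D _ _ => L₀ ≤ Real.log D := by
  refine ForAllLarge.of_le ⌈Real.exp L₀⌉₊ fun D _ χ hD _ _ => ?_
  have hexp : Real.exp L₀ ≤ D := le_trans (Nat.le_ceil _) (by exact_mod_cast hD)
  exact (Real.le_log_iff_exp_le (lt_of_lt_of_le (Real.exp_pos _) hexp)).mpr hexp

omit c' in
/-- `α = π/𝓛⁹`. [cite: Zhang2022LandauSiegel, §2 (2.6), (2.10)] -/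
private theorem alpha_eq (D : ℕ) : alpha D = π / ell D ^ 9 := by rw [alpha, log_bigP]

omit c' in
/-- `α > 0` once `𝓛 > 0`. [cite: Zhang2022LandauSiegel, §2 (2.10)] -/
private theorem alpha_pos_of (h : 0 < ell D) : 0 < alpha D := by
  rw [alpha_eq]; positivity

omit c' in
/-- `α𝓛 ≤ π` once `𝓛 ≥ 1`. [cite: Zhang2022LandauSiegel, §2 (2.10)] -/
private theorem alpha_mul_ell_le (h : 1 ≤ ell D) : alpha D * ell D ≤ π := by
  rw [alpha_eq, div_mul_eq_mul_div, div_le_iff₀ (by positivity)]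
  have : ell D ≤ ell D ^ 9 := le_self_pow₀ h (by norm_num)
  nlinarith [Real.pi_pos]

omit c' in
/-- `α𝓛⁹ = π`. [cite: Zhang2022LandauSiegel, §2 (2.10)] -/
private theorem alpha_mul_ell9 (h : 0 < ell D) : alpha D * ell D ^ 9 = π := by
  rw [alpha_eq, div_mul_cancel₀ _ (by positivity)]

omit D in
/-- The constant `K_β(c′) = 3(1 + 5|c′|π)` (with `‖β_j‖ ≤ K_β α`) is at least `3`. [folklore] -/
private theorem three_le_Kβ : 3 ≤ 3 * (1 + 5 * |c'| * π) := by
  nlinarith [abs_nonneg c', Real.pi_pos]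

/-- `‖β₁‖, ‖β₂‖, ‖β₃‖ ≤ K_β α` (for `𝓛 ≥ 1`). [cite: Zhang2022LandauSiegel, §2 (2.13)] -/
theorem norm_beta123_le (h : 1 ≤ ell D) :
    ‖beta1 c' D‖ ≤ (3 * (1 + 5 * |c'| * π)) * alpha D ∧ ‖beta2 c' D‖ ≤ (3 * (1 + 5 * |c'| * π)) * alpha D ∧
      ‖beta3 c' D‖ ≤ (3 * (1 + 5 * |c'| * π)) * alpha D := by
  have hα : 0 < alpha D := alpha_pos_of (by linarith)
  have hαℓ : alpha D * ell D ≤ π := alpha_mul_ell_le h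
  have hαℓ0 : 0 ≤ alpha D * ell D := by positivity
  have hc : |c'| * (alpha D * ell D) ≤ |c'| * π := mul_le_mul_of_nonneg_left hαℓ (abs_nonneg _)
  have hℓ0 : 0 ≤ ell D := by linarith
  have key : ∀ t : ℝ, |t| ≤ 5 → |1 + t * c' * alpha D * ell D| ≤ 1 + 5 * |c'| * π := by
    intro t ht
    have hm := mul_le_mul ht hc (by positivity) (by norm_num : (0:ℝ) ≤ 5)
    calc |1 + t * c' * alpha D * ell D| ≤ |(1:ℝ)| + |t * c' * alpha D * ell D| := abs_add_le _ _
      _ = 1 + |t| * (|c'| * (alpha D * ell D)) := by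
          rw [abs_one, abs_mul, abs_mul, abs_mul, abs_of_pos hα, abs_of_nonneg hℓ0]
          ring
      _ ≤ 1 + 5 * (|c'| * π) := by linarith
      _ = 1 + 5 * |c'| * π := by ring
  refine ⟨?_, ?_, ?_⟩
  · rw [beta1]
    rw [norm_mul, norm_mul, Complex.norm_I, one_mul, Complex.norm_real, Complex.norm_real,
      Real.norm_eq_abs, Real.norm_eq_abs, abs_of_pos hα]
    have := key (-5) (by norm_num)
    have e : (1 - 5 * c' * alpha D * ell D) = 1 + (-5) * c' * alpha D * ell D := by ring
    rw [e]
    nlinarith [abs_nonneg (1 + (-5) * c' * alpha D * ell D)]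
  · rw [beta2]
    rw [norm_mul, norm_mul, norm_mul, Complex.norm_I, mul_one, Complex.norm_real, Complex.norm_real,
      Real.norm_eq_abs, Real.norm_eq_abs, abs_of_pos hα, Complex.norm_two]
    have := key 1 (by norm_num)
    have e : (1 + c' * alpha D * ell D) = 1 + 1 * c' * alpha D * ell D := by ring
    rw [e]
    nlinarith [abs_nonneg (1 + 1 * c' * alpha D * ell D)]
  · rw [beta3]
    rw [norm_mul, norm_mul, norm_mul, Complex.norm_I, mul_one, Complex.norm_real, Complex.norm_real,
      Real.norm_eq_abs, Real.norm_eq_abs, abs_of_pos hα]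
    have h3 : ‖(3 : ℂ)‖ = 3 := by simp
    rw [h3]
    have := key (-1) (by norm_num)
    have e : (1 - c' * alpha D * ell D) = 1 + (-1) * c' * alpha D * ell D := by ring
    rw [e]
    nlinarith [abs_nonneg (1 + (-1) * c' * alpha D * ell D)]

/-- `‖β_j‖ ≤ K_β α` for every index `j` (convention `β₄ = β₁, β₅ = β₂`). [cite: Zhang2022LandauSiegel, §8 p.45] -/
theorem norm_betaJ_le (h : 1 ≤ ell D) (j : ℕ) : ‖betaJ c' D j‖ ≤ (3 * (1 + 5 * |c'| * π)) * alpha D := by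
  obtain ⟨h1, h2, h3⟩ := norm_beta123_le c' h
  unfold betaJ
  split_ifs <;> assumption

omit c' in
/-- `β₆ = 3iα/2`, `β₇ = 5iα/2`: real part `0`, and `3α/2 ≤ ‖β_μ‖ ≤ 5α/2` (for `α > 0`).
[cite: Zhang2022LandauSiegel, §2 (2.22)] -/
theorem betaMu_facts (h : 0 < ell D) (μ : ℕ) :
    (betaMu D μ).re = 0 ∧ 3 / 2 * alpha D ≤ ‖betaMu D μ‖ ∧ ‖betaMu D μ‖ ≤ 5 / 2 * alpha D := by
  have hα : 0 < alpha D := alpha_pos_of h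
  unfold betaMu
  split_ifs
  · rw [beta7]
    refine ⟨by simp, ?_, ?_⟩ <;>
    · rw [norm_div, norm_mul, norm_mul, Complex.norm_I, mul_one, Complex.norm_real, Real.norm_eq_abs,
        abs_of_pos hα, Complex.norm_two]
      have h5 : ‖(5 : ℂ)‖ = 5 := by simp
      rw [h5]; linarith
  · rw [beta6]
    refine ⟨by simp, ?_, ?_⟩ <;>
    · rw [norm_div, norm_mul, norm_mul, Complex.norm_I, mul_one, Complex.norm_real, Real.norm_eq_abs,
        abs_of_pos hα, Complex.norm_two]
      have h3 : ‖(3 : ℂ)‖ = 3 := by simp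
      rw [h3]; linarith

omit c' in
/-- `‖e^{±β_μ L}‖ = 1` for real `L` (`β_μ` of (2.22) is purely imaginary). [cite: Zhang2022LandauSiegel, §2 (2.22)] -/
private theorem norm_cexp_betaMu_mul (h : 0 < ell D) (μ : ℕ) (L : ℝ) :
    ‖cexp (betaMu D μ * (L : ℂ))‖ = 1 ∧ ‖cexp (-(betaMu D μ * (L : ℂ)))‖ = 1 := by
  have hre : (betaMu D μ).re = 0 := (betaMu_facts h μ).1
  have h1 : (betaMu D μ * (L : ℂ)).re = 0 := by
    rw [Complex.mul_re, hre, Complex.ofReal_im]; ring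
  constructor
  · rw [Complex.norm_exp, h1, Real.exp_zero]
  · rw [Complex.norm_exp, Complex.neg_re, h1, neg_zero, Real.exp_zero]

omit D in
/-- The bound `K_f = 1 + (5/2 + K_β)π` for `‖𝔣_{jμ}(y)‖` is at least `1`. [folklore] -/
private theorem one_le_Kf : 1 ≤ (1 + (5 / 2 + 3 * (1 + 5 * |c'| * π)) * π) := by
  nlinarith [three_le_Kβ c', Real.pi_pos]

omit D in
/-- The bound `K_g = 1 + (8/9)K_β² + (2/3)(K_β + 5/2)²π` for `‖𝔤_{jμ}(y)‖` is at least `1`. [folklore] -/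
private theorem one_le_Kg : 1 ≤ (1 + 8 / 9 * (3 * (1 + 5 * |c'| * π)) ^ 2 + 2 / 3 * (3 * (1 + 5 * |c'| * π) + 5 / 2) ^ 2 * π) := by
  nlinarith [three_le_Kβ c', Real.pi_pos, sq_nonneg (3 * (1 + 5 * |c'| * π)),
    sq_nonneg (3 * (1 + 5 * |c'| * π) + 5 / 2)]

/-- **`‖𝔣_{jμ}(y)‖ ≤ K_f`** for `|log y| ≤ 𝓛⁹ = log P` (`𝓛 ≥ 1`), any `j`, `μ`:
`𝔣_{jμ}(y) = (1 + (β_μ − β_j)log y)y^{β_μ}` with `|y^{β_μ}| = 1`, `‖β_μ − β_j‖log P ≤ (5/2 + K_β)π`.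
[cite: Zhang2022LandauSiegel, §8 Lemma 8.2 p.45] -/
theorem norm_frakfW_le (h : 1 ≤ ell D) (j μ : ℕ) {y : ℝ} (hy : |Real.log y| ≤ ell D ^ 9) :
    ‖frakfW c' D j μ y‖ ≤ (1 + (5 / 2 + 3 * (1 + 5 * |c'| * π)) * π) := by
  have h0 : 0 < ell D := by linarith
  have hα : 0 < alpha D := alpha_pos_of h0
  obtain ⟨-, -, hμ⟩ := betaMu_facts h0 μ
  have hj := norm_betaJ_le c' h j
  have hexp := (norm_cexp_betaMu_mul h0 μ (Real.log y)).1
  have hπ : alpha D * ell D ^ 9 = π := alpha_mul_ell9 h0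
  have hL : ‖(Real.log y : ℂ)‖ ≤ ell D ^ 9 := by
    rw [Complex.norm_real, Real.norm_eq_abs]; exact hy
  rw [frakfW, frakf, norm_mul, hexp, mul_one]
  calc ‖1 + (betaMu D μ - betaJ c' D j) * (Real.log y : ℂ)‖
      ≤ ‖(1 : ℂ)‖ + ‖(betaMu D μ - betaJ c' D j) * (Real.log y : ℂ)‖ := norm_add_le _ _
    _ = 1 + ‖betaMu D μ - betaJ c' D j‖ * ‖(Real.log y : ℂ)‖ := by rw [norm_one, norm_mul]
    _ ≤ 1 + (5 / 2 * alpha D + (3 * (1 + 5 * |c'| * π)) * alpha D) * ell D ^ 9 := by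
        have h1 : ‖betaMu D μ - betaJ c' D j‖ ≤ 5 / 2 * alpha D + (3 * (1 + 5 * |c'| * π)) * alpha D :=
          (norm_sub_le _ _).trans (add_le_add hμ hj)
        have := mul_le_mul h1 hL (norm_nonneg _) (by linarith [norm_nonneg (betaMu D μ - betaJ c' D j)])
        linarith
    _ = (1 + (5 / 2 + 3 * (1 + 5 * |c'| * π)) * π) := by rw [← hπ]; ring

/-- **`‖𝔤_{jμ}(y)‖ ≤ K_g`** for `|log y| ≤ 𝓛⁹` (`𝓛 ≥ 1`), any `j`, `μ`.
[cite: Zhang2022LandauSiegel, §8 Lemma 8.4 p.46] -/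
theorem norm_frakgW_le (h : 1 ≤ ell D) (j μ : ℕ) {y : ℝ} (hy : |Real.log y| ≤ ell D ^ 9) :
    ‖frakgW c' D j μ y‖ ≤
      (1 + 8 / 9 * (3 * (1 + 5 * |c'| * π)) ^ 2 + 2 / 3 * (3 * (1 + 5 * |c'| * π) + 5 / 2) ^ 2 * π) := by
  have h0 : 0 < ell D := by linarith
  have hα : 0 < alpha D := alpha_pos_of h0
  obtain ⟨-, hμlo, hμ⟩ := betaMu_facts h0 μ
  have hμ0 : 0 < ‖betaMu D μ‖ := lt_of_lt_of_le (by positivity) hμlo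
  have hj1 := norm_betaJ_le c' h (j + 1)
  have hj2 := norm_betaJ_le c' h (j + 2)
  have hexp := (norm_cexp_betaMu_mul h0 μ (Real.log y)).2
  have hπ : alpha D * ell D ^ 9 = π := alpha_mul_ell9 h0
  have hL : ‖(Real.log y : ℂ)‖ ≤ ell D ^ 9 := by
    rw [Complex.norm_real, Real.norm_eq_abs]; exact hy
  have hK : 0 ≤ 3 * (1 + 5 * |c'| * π) := by linarith [three_le_Kβ c']
  set β1 := betaJ c' D (j + 1)
  set β2 := betaJ c' D (j + 2)
  set βμ := betaMu D μ
  -- the ratio `β1 β2 / βμ²`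
  have hr : ‖β1 * β2 / βμ ^ 2‖ ≤ 4 / 9 * (3 * (1 + 5 * |c'| * π)) ^ 2 := by
    rw [norm_div, norm_mul, norm_pow]
    rw [div_le_iff₀ (by positivity)]
    calc ‖β1‖ * ‖β2‖ ≤ ((3 * (1 + 5 * |c'| * π)) * alpha D) * ((3 * (1 + 5 * |c'| * π)) * alpha D) := by
          gcongr
      _ = 4 / 9 * (3 * (1 + 5 * |c'| * π)) ^ 2 * (3 / 2 * alpha D) ^ 2 := by ring
      _ ≤ 4 / 9 * (3 * (1 + 5 * |c'| * π)) ^ 2 * ‖βμ‖ ^ 2 := by gcongr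
  -- the factor `(β1 − βμ)(β2 − βμ)/βμ · L`
  have hs : ‖(β1 - βμ) * (β2 - βμ) / βμ * (Real.log y : ℂ)‖ ≤ 2 / 3 * ((3 * (1 + 5 * |c'| * π)) + 5 / 2) ^ 2 * π := by
    have hd1 : ‖β1 - βμ‖ ≤ ((3 * (1 + 5 * |c'| * π)) + 5 / 2) * alpha D :=
      (norm_sub_le _ _).trans (by linarith)
    have hd2 : ‖β2 - βμ‖ ≤ ((3 * (1 + 5 * |c'| * π)) + 5 / 2) * alpha D :=
      (norm_sub_le _ _).trans (by linarith)
    rw [norm_mul, norm_div, norm_mul]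
    have step : ‖β1 - βμ‖ * ‖β2 - βμ‖ / ‖βμ‖ ≤ 2 / 3 * ((3 * (1 + 5 * |c'| * π)) + 5 / 2) ^ 2 * alpha D := by
      rw [div_le_iff₀ hμ0]
      calc ‖β1 - βμ‖ * ‖β2 - βμ‖ ≤ (((3 * (1 + 5 * |c'| * π)) + 5 / 2) * alpha D) * (((3 * (1 + 5 * |c'| * π)) + 5 / 2) * alpha D) := by
            gcongr
        _ = 2 / 3 * ((3 * (1 + 5 * |c'| * π)) + 5 / 2) ^ 2 * alpha D * (3 / 2 * alpha D) := by ring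
        _ ≤ 2 / 3 * ((3 * (1 + 5 * |c'| * π)) + 5 / 2) ^ 2 * alpha D * ‖βμ‖ := by gcongr
    calc ‖β1 - βμ‖ * ‖β2 - βμ‖ / ‖βμ‖ * ‖(Real.log y : ℂ)‖
        ≤ (2 / 3 * ((3 * (1 + 5 * |c'| * π)) + 5 / 2) ^ 2 * alpha D) * ell D ^ 9 := by gcongr
      _ = 2 / 3 * ((3 * (1 + 5 * |c'| * π)) + 5 / 2) ^ 2 * π := by rw [← hπ]; ring
  rw [frakgW, frakg]
  calc ‖β1 * β2 / βμ ^ 2 +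
        (1 - β1 * β2 / βμ ^ 2 - (β1 - βμ) * (β2 - βμ) / βμ * (Real.log y : ℂ)) * cexp (-(βμ * (Real.log y : ℂ)))‖
      ≤ ‖β1 * β2 / βμ ^ 2‖ +
        ‖(1 - β1 * β2 / βμ ^ 2 - (β1 - βμ) * (β2 - βμ) / βμ * (Real.log y : ℂ)) * cexp (-(βμ * (Real.log y : ℂ)))‖ :=
        norm_add_le _ _
    _ = ‖β1 * β2 / βμ ^ 2‖ +
        ‖1 - β1 * β2 / βμ ^ 2 - (β1 - βμ) * (β2 - βμ) / βμ * (Real.log y : ℂ)‖ := by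
        rw [norm_mul, hexp, mul_one]
    _ ≤ ‖β1 * β2 / βμ ^ 2‖ +
        (‖(1 : ℂ)‖ + ‖β1 * β2 / βμ ^ 2‖ + ‖(β1 - βμ) * (β2 - βμ) / βμ * (Real.log y : ℂ)‖) := by
        gcongr
        exact (norm_sub_le _ _).trans (add_le_add (norm_sub_le _ _) le_rfl)
    _ ≤ 4 / 9 * (3 * (1 + 5 * |c'| * π)) ^ 2 + (1 + 4 / 9 * (3 * (1 + 5 * |c'| * π)) ^ 2 + 2 / 3 * ((3 * (1 + 5 * |c'| * π)) + 5 / 2) ^ 2 * π) := by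
        rw [norm_one]; gcongr
    _ = (1 + 8 / 9 * (3 * (1 + 5 * |c'| * π)) ^ 2 + 2 / 3 * (3 * (1 + 5 * |c'| * π) + 5 / 2) ^ 2 * π) := by
        ring

end Sizes


/-! ## The size of the four-integral form `int9cov` and of `S_j(𝐚₁₂,𝐚₂₂)` -/

section IntegralSizes

variable (c' : ℝ) {D : ℕ}

/-- A weighted-`L¹` bound: if `‖F‖ ≤ K_F`, `‖G‖ ≤ K_G` on `(1, B]` then
`‖∫₁^B F(x)G(x)dx/x‖ ≤ K_F K_G log B`. [folklore] -/
private theorem norm_integral_mul_div_le {F G : ℝ → ℂ} {B KF KG : ℝ} (hB : 1 ≤ B) (hKF : 0 ≤ KF)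
    (hF : ∀ x : ℝ, 1 < x → x ≤ B → ‖F x‖ ≤ KF)
    (hG : ∀ x : ℝ, 1 < x → x ≤ B → ‖G x‖ ≤ KG) :
    ‖∫ x in (1:ℝ)..B, F x * G x / (x : ℂ)‖ ≤ KF * KG * Real.log B := by
  have h0 : (0:ℝ) ∉ Set.uIcc (1:ℝ) B := by
    intro h
    rcases Set.mem_uIcc.mp h with ⟨h1, _⟩ | ⟨h1, _⟩ <;> linarith
  have hint : IntervalIntegrable (fun x : ℝ => KF * KG * x⁻¹) MeasureTheory.volume 1 B := by
    refine (ContinuousOn.intervalIntegrable ?_)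
    refine continuousOn_const.mul (continuousOn_inv₀.mono ?_)
    intro x hx hx0
    exact h0 (hx0 ▸ hx)
  have key := intervalIntegral.norm_integral_le_of_norm_le hB
    (f := fun x : ℝ => F x * G x / (x : ℂ)) (g := fun x : ℝ => KF * KG * x⁻¹)
    (MeasureTheory.ae_of_all _ fun x hx => ?_) hint
  · rw [intervalIntegral.integral_const_mul, integral_inv h0, div_one] at key
    exact key
  · obtain ⟨hx1, hxB⟩ := hx
    have hx0 : 0 < x := by linarith
    rw [norm_div, norm_mul, Complex.norm_real, Real.norm_eq_abs, abs_of_pos hx0,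
      div_eq_mul_inv]
    have := mul_le_mul (hF x hx1 hxB) (hG x hx1 hxB) (norm_nonneg _) hKF
    exact mul_le_mul_of_nonneg_right this (inv_nonneg.mpr hx0.le)

omit c' in
/-- `𝓛^{1.1} ≤ 𝓛²` for `𝓛 ≥ 1`. [folklore] -/
private theorem ell_rpow_le_sq (h : 1 ≤ ell D) : ell D ^ (1.1 : ℝ) ≤ ell D ^ 2 := by
  have := Real.rpow_le_rpow_of_exponent_le h (by norm_num : (1.1 : ℝ) ≤ 2)
  rwa [Real.rpow_two] at this

omit c' in
/-- `P > 0`. [cite: Zhang2022LandauSiegel, §2 (2.6)] -/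
private theorem bigP_pos (D : ℕ) : 0 < bigP D := Real.exp_pos _

omit c' in
/-- `T > 0`. [cite: Zhang2022LandauSiegel, §6] -/
private theorem bigT_pos (D : ℕ) : 0 < bigT D := Real.exp_pos _

omit c' in
/-- `log P₃ = 0.498𝓛⁹`. [cite: Zhang2022LandauSiegel, §2 (2.21)] -/
private theorem log_P3 (D : ℕ) : Real.log (P3 D) = 0.498 * ell D ^ 9 := by
  rw [P3, Real.log_rpow (bigP_pos D), log_bigP]

omit c' in
/-- `log P₂ = 0.5𝓛⁹ − 10𝓛^{1.1}`. [cite: Zhang2022LandauSiegel, §2 (2.21), §6] -/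
private theorem log_P2 (D : ℕ) : Real.log (Skeleton.P2 D) = 0.5 * ell D ^ 9 - 10 * ell D ^ (1.1 : ℝ) := by
  rw [Skeleton.P2, Real.log_div (Real.rpow_pos_of_pos (bigP_pos D) _).ne' (pow_pos (bigT_pos D) _).ne',
    Real.log_rpow (bigP_pos D), log_bigP, Real.log_pow, bigT, Real.log_exp]
  push_cast; ring

omit c' in
/-- For `𝓛 ≥ 4`: `10𝓛^{1.1} ≤ 0.002𝓛⁹` (so `P^{0.002} ≥ T^{10}`, `log P₂ ≥ 0.498𝓛⁹`).
[cite: Zhang2022LandauSiegel, §2 (2.21)] -/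
private theorem ten_ell_rpow_le (h : 4 ≤ ell D) : 10 * ell D ^ (1.1 : ℝ) ≤ 0.002 * ell D ^ 9 := by
  have h1 : 1 ≤ ell D := by linarith
  have h2 := ell_rpow_le_sq h1
  have h7 : (4:ℝ) ^ 7 ≤ ell D ^ 7 := pow_le_pow_left₀ (by norm_num) h 7
  have e : ell D ^ 9 = ell D ^ 2 * ell D ^ 7 := by ring
  have h3 : 10 * ell D ^ 2 ≤ 0.002 * ell D ^ 9 := by
    rw [e]
    nlinarith [pow_nonneg (by linarith : (0:ℝ) ≤ ell D) 2]
  linarith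

omit c' in
/-- For `𝓛 ≥ 4`: `0.498𝓛⁹ ≤ log P₂ ≤ 0.5𝓛⁹`.
[cite: Zhang2022LandauSiegel, §2 (2.21)] -/
private theorem log_P2_bounds (h : 4 ≤ ell D) :
    0.498 * ell D ^ 9 ≤ Real.log (Skeleton.P2 D) ∧ Real.log (Skeleton.P2 D) ≤ 0.5 * ell D ^ 9 := by
  rw [log_P2]
  have := ten_ell_rpow_le h
  have h0 : 0 ≤ ell D ^ (1.1 : ℝ) := Real.rpow_nonneg (by linarith) _
  constructor <;> linarith

/-- `‖𝔣_{jμ}(y)‖ ≤ K_f` for `|log y| ≤ 𝓛⁹`, existential form. [cite: Zhang2022LandauSiegel, §8 Lemma 8.2 p.45] -/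
theorem exists_norm_frakfW_le : ∃ Kf : ℝ, 1 ≤ Kf ∧ ∀ (D : ℕ) (j μ : ℕ) (y : ℝ), 1 ≤ ell D →
    |Real.log y| ≤ ell D ^ 9 → ‖frakfW c' D j μ y‖ ≤ Kf := by
  refine ⟨(1 + (5 / 2 + 3 * (1 + 5 * |c'| * π)) * π), one_le_Kf c', ?_⟩
  intro D j μ y h hy
  exact norm_frakfW_le c' h j μ hy

/-- `‖𝔤_{jμ}(y)‖ ≤ K_g` for `|log y| ≤ 𝓛⁹`, existential form. [cite: Zhang2022LandauSiegel, §8 Lemma 8.4 p.46] -/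
theorem exists_norm_frakgW_le : ∃ Kg : ℝ, 1 ≤ Kg ∧ ∀ (D : ℕ) (j μ : ℕ) (y : ℝ), 1 ≤ ell D →
    |Real.log y| ≤ ell D ^ 9 → ‖frakgW c' D j μ y‖ ≤ Kg := by
  refine ⟨(1 + 8 / 9 * (3 * (1 + 5 * |c'| * π)) ^ 2 + 2 / 3 * (3 * (1 + 5 * |c'| * π) + 5 / 2) ^ 2 * π),
    one_le_Kg c', ?_⟩
  intro D j μ y h hy
  exact norm_frakgW_le c' h j μ hy

/-- **`‖int9cov_j‖ ≤ K_I/𝓛⁹`** for `𝓛 ≥ 4`, `K_I = (5/2)K_fK_g(‖ι₃‖ + ‖ι₄‖)²` (each of the four integrals of `Z22:§9.u005` is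
`≪ log P_k/(log P_k)² ≍ 𝓛⁻⁹` since `|𝔣_{jμ}|, |𝔤_{jμ}| ≪ 1` on `[T⁻¹⁰, P]`).
[cite: Zhang2022LandauSiegel, §9 p.51, tex L2619–L2626] -/
theorem exists_norm_int9cov_le :
    ∃ K : ℝ, 0 ≤ K ∧ ∀ (D : ℕ) (j : ℕ), 4 ≤ ell D → ‖int9cov c' D j‖ ≤ K / ell D ^ 9 := by
  obtain ⟨Kf, hKf, hf⟩ := exists_norm_frakfW_le c'
  obtain ⟨Kg, hKg, hg⟩ := exists_norm_frakgW_le c'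
  have hK0 : 0 ≤ 5 / 2 * Kf * Kg * (‖iota3‖ + ‖iota4‖) ^ 2 :=
    mul_nonneg (mul_nonneg (mul_nonneg (by norm_num) (by linarith)) (by linarith)) (sq_nonneg _)
  refine ⟨5 / 2 * Kf * Kg * (‖iota3‖ + ‖iota4‖) ^ 2, hK0, fun D j h => ?_⟩
  have h1 : 1 ≤ ell D := by linarith
  have hℓ : 0 < ell D := by linarith
  have hℓ9 : 0 < ell D ^ 9 := by positivity
  obtain ⟨hP2lo, hP2hi⟩ := log_P2_bounds h
  have hP3 := log_P3 D
  have hten := ten_ell_rpow_le h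
  have hrpow0 : 0 ≤ ell D ^ (1.1 : ℝ) := Real.rpow_nonneg hℓ.le _
  have hP3pos : 0 < Real.log (P3 D) := by rw [hP3]; positivity
  have hP2pos : 0 < Real.log (Skeleton.P2 D) := by linarith [hP2lo, hℓ9]
  have hP3ge : 1 ≤ P3 D := by
    rw [P3]; exact Real.one_le_rpow (Real.one_le_exp (by positivity)) (by norm_num)
  have hP2ge : 1 ≤ Skeleton.P2 D := by
    have : 0 ≤ Real.log (Skeleton.P2 D) := hP2pos.le
    have hP2p : 0 < Skeleton.P2 D := by
      rw [Skeleton.P2]; exact div_pos (Real.rpow_pos_of_pos (bigP_pos D) _) (pow_pos (bigT_pos D) _)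
    rwa [Real.log_nonneg_iff hP2p] at this
  -- the scale ratio `P^{0.002}T^{-10}`
  set ρ : ℝ := bigP D ^ (0.002 : ℝ) / bigT D ^ 10 with hρ
  have hρpos : 0 < ρ := div_pos (Real.rpow_pos_of_pos (bigP_pos D) _) (pow_pos (bigT_pos D) _)
  have hlogρ : Real.log ρ = 0.002 * ell D ^ 9 - 10 * ell D ^ (1.1 : ℝ) := by
    rw [hρ, Real.log_div (Real.rpow_pos_of_pos (bigP_pos D) _).ne' (pow_pos (bigT_pos D) _).ne',
      Real.log_rpow (bigP_pos D), log_bigP, Real.log_pow, bigT, Real.log_exp]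
    push_cast; ring
  -- pointwise bounds on (1, P₃] and (1, P₂]
  have bound1 : ∀ x : ℝ, 1 < x → x ≤ P3 D → |Real.log x| ≤ ell D ^ 9 := by
    intro x hx1 hx3
    have hl0 : 0 < Real.log x := Real.log_pos hx1
    rw [abs_of_pos hl0]
    have := Real.log_le_log (by linarith) hx3
    linarith
  have bound2 : ∀ x : ℝ, 1 < x → x ≤ Skeleton.P2 D → |Real.log x| ≤ ell D ^ 9 := by
    intro x hx1 hx2
    have hl0 : 0 < Real.log x := Real.log_pos hx1
    rw [abs_of_pos hl0]
    have := Real.log_le_log (by linarith) hx2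
    linarith
  have bound3 : ∀ x : ℝ, 1 < x → x ≤ P3 D → |Real.log (ρ * x)| ≤ ell D ^ 9 := by
    intro x hx1 hx3
    have hx0 : 0 < x := by linarith
    rw [Real.log_mul hρpos.ne' hx0.ne', hlogρ, abs_le]
    have hl0 : 0 < Real.log x := Real.log_pos hx1
    have := Real.log_le_log hx0 hx3
    constructor <;> linarith
  have hF6 : ∀ x : ℝ, 1 < x → x ≤ P3 D → ‖frakfW c' D j 6 x‖ ≤ Kf :=
    fun x hx1 hx3 => hf D j 6 x h1 (bound1 x hx1 hx3)
  have hG6 : ∀ x : ℝ, 1 < x → x ≤ P3 D → ‖frakgW c' D j 6 x‖ ≤ Kg :=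
    fun x hx1 hx3 => hg D j 6 x h1 (bound1 x hx1 hx3)
  have hF7 : ∀ x : ℝ, 1 < x → x ≤ Skeleton.P2 D → ‖frakfW c' D j 7 x‖ ≤ Kf :=
    fun x hx1 hx2 => hf D j 7 x h1 (bound2 x hx1 hx2)
  have hG7 : ∀ x : ℝ, 1 < x → x ≤ Skeleton.P2 D → ‖frakgW c' D j 7 x‖ ≤ Kg :=
    fun x hx1 hx2 => hg D j 7 x h1 (bound2 x hx1 hx2)
  have hG7ρ : ∀ x : ℝ, 1 < x → x ≤ P3 D → ‖frakgW c' D j 7 (ρ * x)‖ ≤ Kg :=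
    fun x hx1 hx3 => hg D j 7 (ρ * x) h1 (bound3 x hx1 hx3)
  have hF7ρ : ∀ x : ℝ, 1 < x → x ≤ P3 D → ‖frakfW c' D j 7 (ρ * x)‖ ≤ Kf :=
    fun x hx1 hx3 => hf D j 7 (ρ * x) h1 (bound3 x hx1 hx3)
  have hKf0 : 0 ≤ Kf := by linarith
  -- the four integrals
  have I1 := norm_integral_mul_div_le hP3ge hKf0 hF6 hG6
  have I2 := norm_integral_mul_div_le hP2ge hKf0 hF7 hG7
  have I3 := norm_integral_mul_div_le hP3ge hKf0 hF6 hG7ρ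
  have I4 := norm_integral_mul_div_le hP3ge hKf0 hF7ρ hG6
  -- norms of the prefactors
  have n3 : ‖(Complex.normSq iota3 : ℂ)‖ = ‖iota3‖ ^ 2 := by
    rw [Complex.norm_real, Real.norm_eq_abs, abs_of_nonneg (Complex.normSq_nonneg _),
      Complex.normSq_eq_norm_sq]
  have n4 : ‖(Complex.normSq iota4 : ℂ)‖ = ‖iota4‖ ^ 2 := by
    rw [Complex.norm_real, Real.norm_eq_abs, abs_of_nonneg (Complex.normSq_nonneg _),
      Complex.normSq_eq_norm_sq]
  have nl3 : ‖(Real.log (P3 D) : ℂ)‖ = Real.log (P3 D) := by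
    rw [Complex.norm_real, Real.norm_eq_abs, abs_of_pos hP3pos]
  have nl2 : ‖(Real.log (Skeleton.P2 D) : ℂ)‖ = Real.log (Skeleton.P2 D) := by
    rw [Complex.norm_real, Real.norm_eq_abs, abs_of_pos hP2pos]
  set L3 := Real.log (P3 D) with hL3
  set L2 := Real.log (Skeleton.P2 D) with hL2
  set A1 := ∫ x in (1 : ℝ)..P3 D, frakfW c' D j 6 x * frakgW c' D j 6 x / (x : ℂ)
  set A2 := ∫ x in (1 : ℝ)..Skeleton.P2 D, frakfW c' D j 7 x * frakgW c' D j 7 x / (x : ℂ)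
  set A3 := ∫ x in (1 : ℝ)..P3 D, frakfW c' D j 6 x * frakgW c' D j 7 (ρ * x) / (x : ℂ)
  set A4 := ∫ x in (1 : ℝ)..P3 D, frakfW c' D j 7 (ρ * x) * frakgW c' D j 6 x / (x : ℂ)
  have T1 : ‖(Complex.normSq iota3 : ℂ) / (L3 : ℂ) ^ 2 * A1‖ ≤ ‖iota3‖ ^ 2 * (Kf * Kg) / L3 := by
    rw [norm_mul, norm_div, norm_pow, n3, nl3]
    calc ‖iota3‖ ^ 2 / L3 ^ 2 * ‖A1‖ ≤ ‖iota3‖ ^ 2 / L3 ^ 2 * (Kf * Kg * L3) := by gcongr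
      _ = ‖iota3‖ ^ 2 * (Kf * Kg) / L3 := by field_simp
  have T2 : ‖(Complex.normSq iota4 : ℂ) / (L2 : ℂ) ^ 2 * A2‖ ≤ ‖iota4‖ ^ 2 * (Kf * Kg) / L2 := by
    rw [norm_mul, norm_div, norm_pow, n4, nl2]
    calc ‖iota4‖ ^ 2 / L2 ^ 2 * ‖A2‖ ≤ ‖iota4‖ ^ 2 / L2 ^ 2 * (Kf * Kg * L2) := by gcongr
      _ = ‖iota4‖ ^ 2 * (Kf * Kg) / L2 := by field_simp
  have T3 : ‖conj iota3 * iota4 / ((L2 : ℂ) * (L3 : ℂ)) * A3‖ ≤ ‖iota3‖ * ‖iota4‖ * (Kf * Kg) / L2 := by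
    rw [norm_mul, norm_div, norm_mul, norm_mul, Complex.norm_conj, nl2, nl3]
    calc ‖iota3‖ * ‖iota4‖ / (L2 * L3) * ‖A3‖ ≤ ‖iota3‖ * ‖iota4‖ / (L2 * L3) * (Kf * Kg * L3) := by
          gcongr
      _ = ‖iota3‖ * ‖iota4‖ * (Kf * Kg) / L2 := by field_simp
  have T4 : ‖conj iota4 * iota3 / ((L2 : ℂ) * (L3 : ℂ)) * A4‖ ≤ ‖iota3‖ * ‖iota4‖ * (Kf * Kg) / L2 := by
    rw [norm_mul, norm_div, norm_mul, norm_mul, Complex.norm_conj, nl2, nl3]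
    calc ‖iota4‖ * ‖iota3‖ / (L2 * L3) * ‖A4‖ ≤ ‖iota4‖ * ‖iota3‖ / (L2 * L3) * (Kf * Kg * L3) := by
          gcongr
      _ = ‖iota3‖ * ‖iota4‖ * (Kf * Kg) / L2 := by field_simp
  -- `1/L3, 1/L2 ≤ 2.5/𝓛⁹`
  have hinv3 : 1 / L3 ≤ 5 / 2 / ell D ^ 9 := by
    rw [hP3, div_le_div_iff₀ (by positivity) hℓ9]; linarith
  have hinv2 : 1 / L2 ≤ 5 / 2 / ell D ^ 9 := by
    rw [div_le_div_iff₀ hP2pos hℓ9]; linarith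
  have e : int9cov c' D j = (Complex.normSq iota3 : ℂ) / (L3 : ℂ) ^ 2 * A1 +
      (Complex.normSq iota4 : ℂ) / (L2 : ℂ) ^ 2 * A2 +
      conj iota3 * iota4 / ((L2 : ℂ) * (L3 : ℂ)) * A3 +
      conj iota4 * iota3 / ((L2 : ℂ) * (L3 : ℂ)) * A4 := rfl
  rw [e]
  have hKf0 : 0 ≤ Kf := by linarith
  have hKg0 : 0 ≤ Kg := by linarith
  have hKK : 0 ≤ Kf * Kg := mul_nonneg hKf0 hKg0
  have hn1 : 0 ≤ ‖iota3‖ ^ 2 * (Kf * Kg) := mul_nonneg (sq_nonneg _) hKK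
  have hn2 : 0 ≤ (‖iota4‖ ^ 2 + 2 * (‖iota3‖ * ‖iota4‖)) * (Kf * Kg) :=
    mul_nonneg (add_nonneg (sq_nonneg _)
      (mul_nonneg zero_le_two (mul_nonneg (norm_nonneg _) (norm_nonneg _)))) hKK
  calc ‖(Complex.normSq iota3 : ℂ) / (L3 : ℂ) ^ 2 * A1 + (Complex.normSq iota4 : ℂ) / (L2 : ℂ) ^ 2 * A2 +
        conj iota3 * iota4 / ((L2 : ℂ) * (L3 : ℂ)) * A3 + conj iota4 * iota3 / ((L2 : ℂ) * (L3 : ℂ)) * A4‖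
      ≤ ‖(Complex.normSq iota3 : ℂ) / (L3 : ℂ) ^ 2 * A1‖ + ‖(Complex.normSq iota4 : ℂ) / (L2 : ℂ) ^ 2 * A2‖ +
        ‖conj iota3 * iota4 / ((L2 : ℂ) * (L3 : ℂ)) * A3‖ + ‖conj iota4 * iota3 / ((L2 : ℂ) * (L3 : ℂ)) * A4‖ := by
        refine (norm_add_le _ _).trans (add_le_add ((norm_add_le _ _).trans (add_le_add (norm_add_le _ _) le_rfl)) le_rfl)
    _ ≤ ‖iota3‖ ^ 2 * (Kf * Kg) / L3 + ‖iota4‖ ^ 2 * (Kf * Kg) / L2 +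
        ‖iota3‖ * ‖iota4‖ * (Kf * Kg) / L2 + ‖iota3‖ * ‖iota4‖ * (Kf * Kg) / L2 :=
        add_le_add (add_le_add (add_le_add T1 T2) T3) T4
    _ = (‖iota3‖ ^ 2 * (Kf * Kg)) * (1 / L3) +
        ((‖iota4‖ ^ 2 + 2 * (‖iota3‖ * ‖iota4‖)) * (Kf * Kg)) * (1 / L2) := by ring
    _ ≤ (‖iota3‖ ^ 2 * (Kf * Kg)) * (5 / 2 / ell D ^ 9) +
        ((‖iota4‖ ^ 2 + 2 * (‖iota3‖ * ‖iota4‖)) * (Kf * Kg)) * (5 / 2 / ell D ^ 9) :=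
        add_le_add (mul_le_mul_of_nonneg_left hinv3 hn1) (mul_le_mul_of_nonneg_left hinv2 hn2)
    _ = 5 / 2 * Kf * Kg * (‖iota3‖ + ‖iota4‖) ^ 2 / ell D ^ 9 := by ring

/-- **`S_j(𝐚₁₂,𝐚₂₂) ≪ 𝔞α + o(α)`**, quantitatively: if `‖S_j − 𝔞·int9cov_j‖ ≤ eα` (the content of
`Z22:§9.u005`), `‖int9cov_j‖ ≤ K𝓛⁻⁹` and `𝓛 ≥ 4`, then `‖S_j‖ ≤ (360000K + πe)𝓛⁻⁵` (by
`𝔞 ≤ 360000𝓛⁴`, `α = π𝓛⁻⁹`). This is the manuscript's implicit `E(𝐚₁₂,𝐚₂₂) = o(𝔓)`.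
[cite: Zhang2022LandauSiegel, §9 p.52, tex L2646; §7 Prop. 7.1 p.33] -/
theorem norm_Sj_le_of_u005 [NeZero D] (χ : DirichletCharacter ℂ D) (hp : χ.IsPrimitive)
    (h : 4 ≤ ell D) {j : ℕ} {e K : ℝ} (he : 0 ≤ e) (hKI : 0 ≤ K)
    (hI : ‖int9cov c' D j‖ ≤ K / ell D ^ 9) {S : ℂ}
    (hS : ‖S - (frakA χ : ℂ) * int9cov c' D j‖ ≤ e * alpha D) :
    ‖S‖ ≤ (360000 * K + π * e) / ell D ^ 5 := by
  have hℓ : 0 < ell D := by linarith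
  have h1 : 1 ≤ ell D := by linarith
  have hA := frakA_le_log_pow_four χ (by rw [← ell]; linarith) hp
  rw [← ell] at hA
  have hA0 := frakA_nonneg χ
  have hα : alpha D = π / ell D ^ 9 := alpha_eq D
  calc ‖S‖ = ‖(S - (frakA χ : ℂ) * int9cov c' D j) + (frakA χ : ℂ) * int9cov c' D j‖ := by ring_nf
    _ ≤ ‖S - (frakA χ : ℂ) * int9cov c' D j‖ + ‖(frakA χ : ℂ) * int9cov c' D j‖ := norm_add_le _ _
    _ ≤ e * alpha D + frakA χ * (K / ell D ^ 9) := by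
        rw [norm_mul, Complex.norm_real, Real.norm_eq_abs, abs_of_nonneg hA0]
        gcongr
    _ ≤ e * (π / ell D ^ 9) + 360000 * ell D ^ 4 * (K / ell D ^ 9) := by
        rw [hα]; gcongr
    _ = e * π / ell D ^ 9 + 360000 * K / ell D ^ 5 := by
        field_simp
    _ ≤ e * π / ell D ^ 5 + 360000 * K / ell D ^ 5 := by
        have h59 : ell D ^ 5 ≤ ell D ^ 9 := pow_le_pow_right₀ h1 (by norm_num)
        have := div_le_div_of_nonneg_left (by positivity : 0 ≤ e * π) (by positivity) h59
        linarith
    _ = (360000 * K + π * e) / ell D ^ 5 := by ring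

end IntegralSizes

/-! ## `Z22:§9.u007`: "It follows by Proposition 7.1 that `Θ₁(𝐚₁₂,𝐚₂₂) = B₂𝔞𝔓 + o(𝔓)`" -/

section Prop71Step

variable (c' : ℝ)

/-- `mainMV = wsum9 · 𝔓` (the main term of Prop. 7.1 is the weighted sum of the `S_j` times `𝔓`).
[cite: Zhang2022LandauSiegel, §7 Prop. 7.1 p.33; §9 p.51, tex L2627] -/
theorem mainMV_eq_wsum9_mul {D : ℕ} [NeZero D] (χ : DirichletCharacter ℂ D) (hα : alpha D ≠ 0) :
    mainMV c' D (a12 χ) (a22 χ) = wsum9 c' χ * (frakP D : ℂ) := by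
  have hαC : (alpha D : ℂ) ≠ 0 := by exact_mod_cast hα
  simp only [mainMV, wsum9]
  field_simp

/-- `E(𝐚₁₂,𝐚₂₂) ≤ 3(360000K_I + πe)·𝔓𝓛⁻³` under the per-`j` bounds of `norm_Sj_le_of_u005`.
[cite: Zhang2022LandauSiegel, §7 Prop. 7.1 p.33; §9 p.52] -/
theorem Ecal_le : ∃ K : ℝ, 0 ≤ K ∧ ∀ (D : ℕ) [NeZero D] (χ : DirichletCharacter ℂ D),
    χ.IsPrimitive → 4 ≤ ell D → ∀ (e : ℝ), 0 ≤ e →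
    (∀ j ∈ ({1, 2, 3} : Finset ℕ),
      ‖Sj c' D j (a12 χ) (a22 χ) - (frakA χ : ℂ) * int9cov c' D j‖ ≤ e * alpha D) →
    Ecal c' D (a12 χ) (a22 χ) ≤ 3 * (360000 * K + π * e) * frakP D / ell D ^ 3 := by
  obtain ⟨K, hK, hI⟩ := exists_norm_int9cov_le c'
  refine ⟨K, hK, fun D _ χ hp h e he hS => ?_⟩
  have hℓ : 0 < ell D := by linarith
  have b1 := norm_Sj_le_of_u005 c' χ hp h he hK (hI D 1 h) (hS 1 (by simp))
  have b2 := norm_Sj_le_of_u005 c' χ hp h he hK (hI D 2 h) (hS 2 (by simp))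
  have b3 := norm_Sj_le_of_u005 c' χ hp h he hK (hI D 3 h) (hS 3 (by simp))
  have hP := frakP_nonneg D
  rw [Ecal]
  calc frakP D * ell D ^ 2 *
        (‖Sj c' D 1 (a12 χ) (a22 χ)‖ + ‖Sj c' D 2 (a12 χ) (a22 χ)‖ + ‖Sj c' D 3 (a12 χ) (a22 χ)‖)
      ≤ frakP D * ell D ^ 2 * ((360000 * K + π * e) / ell D ^ 5 + (360000 * K + π * e) / ell D ^ 5 +
          (360000 * K + π * e) / ell D ^ 5) := by gcongr
    _ = 3 * (360000 * K + π * e) * frakP D / ell D ^ 3 := by field_simp; ring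

/-- **`Z22:§9.u007` INFERENCE (second reading), DISCHARGED from Prop. 7.1, the per-`j` integral form
`Z22:§9.u005` and the weighted-sum evaluation `Z22:§9.u006` (c-reading):**
`Prop71 c' → Step9u005 c' → Step9u006c c' → Step9u007c c'`. The manuscript's one-line "It follows by
Proposition 7.1" uses, besides the weighted sum, that `E(𝐚₁₂,𝐚₂₂) = 𝔓𝓛²Σ|S_j| = o(𝔓)`; this is
supplied here by `Z22:§9.u005` (per-`j` sizes `S_j ≪ 𝔞α`) and `𝔞 ≪ 𝓛⁴` (`frakA_le_log_pow_four`).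
(The typed `Ded9u007 : Prop71 → Step9u006 → Step9u007` omits the per-`j` input; see the GAP-LEDGER note of
seat d17.) [cite: Zhang2022LandauSiegel, §9 p.52, tex L2646–L2649; §7 Prop. 7.1 p.33] -/
theorem step9u007c_of : Prop71 c' → Step9u005 c' → Step9u006c c' → Step9u007c c' := by
  intro h71 h5 h6 ε hε
  obtain ⟨K, hKI, hEcal⟩ := Ecal_le c'
  obtain ⟨C, hC⟩ := h71 (‖iota3‖ + ‖iota4‖) (ε / 3) (by positivity)
  have h5' := h5 1 one_pos
  have h6' := h6 (ε / 3) (by positivity)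
  set Cp : ℝ := max C 1 with hCp
  have hCp1 : 1 ≤ Cp := le_max_right _ _
  have hCp0 : 0 ≤ Cp := by linarith
  set M : ℝ := 9 * Cp * (360000 * K + π * 1) / ε with hM
  have hM0 : 0 ≤ M := by positivity
  have hlog := forAllLarge_log_ge (M + 4)
  refine (hC.and (h5'.and (h6'.and hlog))).mono ?_
  intro D _ χ hq hp ⟨H71, H5, H6, HL⟩ hA
  have hℓ3 : 4 ≤ ell D := by rw [ell]; linarith
  have hℓ : 0 < ell D := by linarith
  have hℓM : M ≤ ell D := by rw [ell]; linarith
  have hD2 : 2 ≤ Real.log D := by linarith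
  have hα0 : alpha D ≠ 0 := (alpha_pos_of hℓ).ne'
  have hP := frakP_nonneg D
  have H5j := H5 hA
  have hE := hEcal D χ hp hℓ3 1 zero_le_one (by simpa using H5j)
  have hmain := H71 hA (a12 χ) (a22 χ) (adm72_a12 χ hD2) (adm72_a22 χ hD2)
  have hw := H6 hA
  -- `C · E ≤ (ε/3)𝔓`
  have hCE : C * Ecal c' D (a12 χ) (a22 χ) ≤ ε / 3 * frakP D := by
    have hE0 : 0 ≤ Ecal c' D (a12 χ) (a22 χ) := by rw [Ecal]; positivity
    have step1 : C * Ecal c' D (a12 χ) (a22 χ) ≤ Cp * Ecal c' D (a12 χ) (a22 χ) :=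
      mul_le_mul_of_nonneg_right (le_max_left _ _) hE0
    have step2 : Cp * Ecal c' D (a12 χ) (a22 χ) ≤
        Cp * (3 * (360000 * K + π * 1) * frakP D / ell D ^ 3) :=
      mul_le_mul_of_nonneg_left hE hCp0
    have hℓ3' : ell D ≤ ell D ^ 3 := le_self_pow₀ (by linarith) (by norm_num)
    have hMℓ3 : M ≤ ell D ^ 3 := hℓM.trans hℓ3'
    have step3 : Cp * (3 * (360000 * K + π * 1) * frakP D / ell D ^ 3) ≤ ε / 3 * frakP D := by
      rw [show Cp * (3 * (360000 * K + π * 1) * frakP D / ell D ^ 3) =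
          (M * (ε / 3)) * frakP D / ell D ^ 3 by rw [hM]; field_simp; ring]
      rw [div_le_iff₀ (by positivity)]
      have : M * (ε / 3) * frakP D ≤ ell D ^ 3 * (ε / 3) * frakP D := by gcongr
      linarith
    linarith
  -- assemble
  have e1 : mainMV c' D (a12 χ) (a22 χ) = wsum9 c' χ * (frakP D : ℂ) := mainMV_eq_wsum9_mul c' χ hα0
  have hnP : ‖(frakP D : ℂ)‖ = frakP D := by
    rw [Complex.norm_real, Real.norm_eq_abs, abs_of_nonneg hP]
  calc ‖Theta1 c' χ (a12 χ) (a22 χ) - Theta1Coeff9 * (frakA χ : ℂ) * (frakP D : ℂ)‖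
      = ‖(Theta1 c' χ (a12 χ) (a22 χ) - mainMV c' D (a12 χ) (a22 χ)) +
          (wsum9 c' χ - (frakA χ : ℂ) * Theta1Coeff9) * (frakP D : ℂ)‖ := by
        rw [e1]; ring_nf
    _ ≤ ‖Theta1 c' χ (a12 χ) (a22 χ) - mainMV c' D (a12 χ) (a22 χ)‖ +
          ‖(wsum9 c' χ - (frakA χ : ℂ) * Theta1Coeff9) * (frakP D : ℂ)‖ := norm_add_le _ _
    _ ≤ (C * Ecal c' D (a12 χ) (a22 χ) + ε / 3 * frakP D) + ε / 3 * frakP D := by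
        rw [norm_mul, hnP]
        gcongr
    _ ≤ ε * frakP D := by linarith

/-- The printed-reading analogue: `Prop71 c' → Step9u005 c' → Step9u006 c' → Step9u007 c'` (same proof
with the printed coefficient `coeff97`). [cite: Zhang2022LandauSiegel, §9 p.52, tex L2646–L2649] -/
theorem step9u007_of : Prop71 c' → Step9u005 c' → Step9u006 c' → Step9u007 c' := by
  intro h71 h5 h6 ε hε
  obtain ⟨K, hKI, hEcal⟩ := Ecal_le c'
  obtain ⟨C, hC⟩ := h71 (‖iota3‖ + ‖iota4‖) (ε / 3) (by positivity)
  have h5' := h5 1 one_pos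
  have h6' := h6 (ε / 3) (by positivity)
  set Cp : ℝ := max C 1 with hCp
  have hCp1 : 1 ≤ Cp := le_max_right _ _
  have hCp0 : 0 ≤ Cp := by linarith
  set M : ℝ := 9 * Cp * (360000 * K + π * 1) / ε with hM
  have hM0 : 0 ≤ M := by positivity
  have hlog := forAllLarge_log_ge (M + 4)
  refine (hC.and (h5'.and (h6'.and hlog))).mono ?_
  intro D _ χ hq hp ⟨H71, H5, H6, HL⟩ hA
  have hℓ3 : 4 ≤ ell D := by rw [ell]; linarith
  have hℓ : 0 < ell D := by linarith
  have hℓM : M ≤ ell D := by rw [ell]; linarith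
  have hD2 : 2 ≤ Real.log D := by linarith
  have hα0 : alpha D ≠ 0 := (alpha_pos_of hℓ).ne'
  have hP := frakP_nonneg D
  have H5j := H5 hA
  have hE := hEcal D χ hp hℓ3 1 zero_le_one (by simpa using H5j)
  have hmain := H71 hA (a12 χ) (a22 χ) (adm72_a12 χ hD2) (adm72_a22 χ hD2)
  have hw := H6 hA
  have hCE : C * Ecal c' D (a12 χ) (a22 χ) ≤ ε / 3 * frakP D := by
    have hE0 : 0 ≤ Ecal c' D (a12 χ) (a22 χ) := by rw [Ecal]; positivity
    have step1 : C * Ecal c' D (a12 χ) (a22 χ) ≤ Cp * Ecal c' D (a12 χ) (a22 χ) :=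
      mul_le_mul_of_nonneg_right (le_max_left _ _) hE0
    have step2 : Cp * Ecal c' D (a12 χ) (a22 χ) ≤
        Cp * (3 * (360000 * K + π * 1) * frakP D / ell D ^ 3) :=
      mul_le_mul_of_nonneg_left hE hCp0
    have hℓ3' : ell D ≤ ell D ^ 3 := le_self_pow₀ (by linarith) (by norm_num)
    have hMℓ3 : M ≤ ell D ^ 3 := hℓM.trans hℓ3'
    have step3 : Cp * (3 * (360000 * K + π * 1) * frakP D / ell D ^ 3) ≤ ε / 3 * frakP D := by
      rw [show Cp * (3 * (360000 * K + π * 1) * frakP D / ell D ^ 3) =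
          (M * (ε / 3)) * frakP D / ell D ^ 3 by rw [hM]; field_simp; ring]
      rw [div_le_iff₀ (by positivity)]
      have : M * (ε / 3) * frakP D ≤ ell D ^ 3 * (ε / 3) * frakP D := by gcongr
      linarith
    linarith
  have e1 : mainMV c' D (a12 χ) (a22 χ) = wsum9 c' χ * (frakP D : ℂ) := mainMV_eq_wsum9_mul c' χ hα0
  have hnP : ‖(frakP D : ℂ)‖ = frakP D := by
    rw [Complex.norm_real, Real.norm_eq_abs, abs_of_nonneg hP]
  calc ‖Theta1 c' χ (a12 χ) (a22 χ) - coeff97 * (frakA χ : ℂ) * (frakP D : ℂ)‖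
      = ‖(Theta1 c' χ (a12 χ) (a22 χ) - mainMV c' D (a12 χ) (a22 χ)) +
          (wsum9 c' χ - (frakA χ : ℂ) * coeff97) * (frakP D : ℂ)‖ := by
        rw [e1]; ring_nf
    _ ≤ ‖Theta1 c' χ (a12 χ) (a22 χ) - mainMV c' D (a12 χ) (a22 χ)‖ +
          ‖(wsum9 c' χ - (frakA χ : ℂ) * coeff97) * (frakP D : ℂ)‖ := norm_add_le _ _
    _ ≤ (C * Ecal c' D (a12 χ) (a22 χ) + ε / 3 * frakP D) + ε / 3 * frakP D := by
        rw [norm_mul, hnP]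
        gcongr
    _ ≤ ε * frakP D := by linarith

end Prop71Step


/-! ## `Z22:§9.u005`: the change of variables `x → P₂/x`, `x → P₃/x` -/

section ChangeOfVariables

variable (c' : ℝ) {D : ℕ}

/-- `𝔣_{jμ}` of Lemma 8.2 is continuous on `(0,∞)`. [cite: Zhang2022LandauSiegel, §8 Lemma 8.2 p.45] -/
theorem continuousOn_frakfW (j μ : ℕ) : ContinuousOn (fun y : ℝ => frakfW c' D j μ y) (Set.Ioi 0) := by
  have hc : Continuous fun L : ℂ => frakf (betaJ c' D j) (betaMu D μ) L := by
    unfold frakf; fun_prop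
  exact hc.comp_continuousOn continuousOn_ofReal_log

/-- `𝔤_{jμ}` of Lemma 8.4 is continuous on `(0,∞)`. [cite: Zhang2022LandauSiegel, §8 Lemma 8.4 p.46] -/
theorem continuousOn_frakgW (j μ : ℕ) : ContinuousOn (fun y : ℝ => frakgW c' D j μ y) (Set.Ioi 0) := by
  have hc : Continuous fun L : ℂ => frakg (betaJ c' D (j + 1)) (betaJ c' D (j + 2)) (betaMu D μ) L := by
    unfold frakg; fun_prop
  exact hc.comp_continuousOn continuousOn_ofReal_log

omit c' in
/-- `Ppow 1 (log p) = p` for `p > 0`. [folklore] -/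
private theorem Ppow_one_log {p : ℝ} (hp : 0 < p) : Ppow 1 (Real.log p) = p := by
  rw [Ppow, one_mul, Real.exp_log hp]

omit c' in
/-- `P₂, P₃ > 0`. [cite: Zhang2022LandauSiegel, §2 (2.21)] -/
private theorem P2_pos_P3_pos (D : ℕ) : 0 < Skeleton.P2 D ∧ 0 < P3 D :=
  ⟨div_pos (Real.rpow_pos_of_pos (bigP_pos D) _) (pow_pos (bigT_pos D) _),
    Real.rpow_pos_of_pos (bigP_pos D) _⟩

omit c' in
/-- **"since `P₂/P₃ = P^{0.002}T^{−10}`"** ((2.21): `P₂ = P^{0.5}T^{−10}`, `P₃ = P^{0.498}`).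
[cite: Zhang2022LandauSiegel, §9 p.51, tex L2626] -/
private theorem P2_div_P3 (D : ℕ) : Skeleton.P2 D / P3 D = bigP D ^ (0.002 : ℝ) / bigT D ^ 10 := by
  rw [Skeleton.P2, P3, div_right_comm, ← Real.rpow_sub (bigP_pos D)]
  norm_num

/-- The two-integral form of `Z22:§9.u004` (reading r) IS the tree's `S811g` at the scales `(P₂, P₃)`
with coefficients `(ῑ₄, ῑ₃; ι₄, ι₃)` and profiles `(𝔣_{j7}, 𝔣_{j6}; 𝔤_{j7}, 𝔤_{j6})`.
[cite: Zhang2022LandauSiegel, §9 p.51, tex L2613–L2618] -/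
theorem int9main_add_tail_eq_S811g (D : ℕ) (j : ℕ) :
    int9main c' D j + (Complex.normSq iota4 : ℂ) * int9tail c' D j =
      S811g (conj iota4) (conj iota3) iota4 iota3
        (fun y => frakfW c' D j 7 y) (fun y => frakfW c' D j 6 y)
        (fun y => frakgW c' D j 7 y) (fun y => frakgW c' D j 6 y)
        1 (Real.log (Skeleton.P2 D)) (Real.log (P3 D)) := by
  obtain ⟨h2, h3⟩ := P2_pos_P3_pos D
  unfold S811g int9main int9tail
  rw [Ppow_one_log h2, Ppow_one_log h3, Complex.normSq_eq_conj_mul_self]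
  have e1 : (∫ x in (1 : ℝ)..P3 D,
      (conj iota3 * frakfW c' D j 6 (P3 D / x) / (Real.log (P3 D) : ℂ) +
          conj iota4 * frakfW c' D j 7 (Skeleton.P2 D / x) / (Real.log (Skeleton.P2 D) : ℂ)) *
        (iota3 * frakgW c' D j 6 (P3 D / x) / (Real.log (P3 D) : ℂ) +
          iota4 * frakgW c' D j 7 (Skeleton.P2 D / x) / (Real.log (Skeleton.P2 D) : ℂ)) / (x : ℂ)) =
      ∫ x in (1 : ℝ)..P3 D,
        (conj iota4 * frakfW c' D j 7 (Skeleton.P2 D / x) / (Real.log (Skeleton.P2 D) : ℂ) +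
            conj iota3 * frakfW c' D j 6 (P3 D / x) / (Real.log (P3 D) : ℂ)) *
          (iota4 * frakgW c' D j 7 (Skeleton.P2 D / x) / (Real.log (Skeleton.P2 D) : ℂ) +
            iota3 * frakgW c' D j 6 (P3 D / x) / (Real.log (P3 D) : ℂ)) / (x : ℂ) :=
    intervalIntegral.integral_congr fun x _ => by ring
  rw [e1]
  ring

/-- The four-integral form `int9cov` of `Z22:§9.u005` IS the tree's `S812g` at the same data
(using `P₂/P₃ = P^{0.002}T^{−10}`). [cite: Zhang2022LandauSiegel, §9 p.51, tex L2619–L2626] -/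
theorem int9cov_eq_S812g (D : ℕ) (j : ℕ) :
    int9cov c' D j =
      S812g (conj iota4) (conj iota3) iota4 iota3
        (fun y => frakfW c' D j 7 y) (fun y => frakfW c' D j 6 y)
        (fun y => frakgW c' D j 7 y) (fun y => frakgW c' D j 6 y)
        1 (Real.log (Skeleton.P2 D)) (Real.log (P3 D)) := by
  obtain ⟨h2, h3⟩ := P2_pos_P3_pos D
  unfold S812g int9cov
  rw [Ppow_one_log h2, Ppow_one_log h3, P2_div_P3]
  simp only [Complex.normSq_eq_conj_mul_self]
  ring

/-- **`Z22:§9.u005` INFERENCE, DISCHARGED**: `Step9u004r c' → Step9u005 c'` — the change of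
variables `x → P₂/x`, `x → P₃/x` is the tree's identity `S811g_eq_S812g` (valid for any profiles
continuous on `(0,∞)`, here `𝔣_{jμ}, 𝔤_{jμ}` at the actual shifts), so the two main terms coincide
EXACTLY and the `o(α)` is inherited. [cite: Zhang2022LandauSiegel, §9 p.51, tex L2619–L2626] -/
theorem ded9u005_holds : Ded9u005 c' := by
  intro h4 ε hε
  refine (h4 ε hε).mono ?_
  intro D _ χ _ _ H hA j hj
  have key := H hA j hj
  rw [int9main_add_tail_eq_S811g,
    S811g_eq_S812g _ _ _ _ (continuousOn_frakfW c' j 7) (continuousOn_frakfW c' j 6)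
      (continuousOn_frakgW c' j 7) (continuousOn_frakgW c' j 6),
    ← int9cov_eq_S812g] at key
  exact key

/-- `Ded9u005` — `_holds` alias of `ded9u005_holds` above under the fact's exact name (appended
2026-08-28, D-0026 bookkeeping: the proof term is the existing theorem of this file; no statement,
definition or attribute is edited; no new named fact; the ledger's debt table listed the fact
unproved). [cite: Zhang2022LandauSiegel, §9 p.51, tex L2619–L2626] -/
theorem _root_.Literature.NumberTheory.LFunctions.Zhang2022.Section9Statements.Ded9u005_holds :
    Ded9u005 c' :=
  _root_.Literature.NumberTheory.LFunctions.Zhang2022.Section9Discharge.ded9u005_holds (c' := c')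

end ChangeOfVariables


/-! ## `Z22:§9.u002`, `Z22:§9.u003`: Lemmas 8.2 and 8.4 at `x = P₃/(dr)`, `μ = 6` -/

section LemmaApplications

variable (c' : ℝ) {D : ℕ}

omit c' in
/-- `β_μ` at `μ = 6` is `β₆`. [cite: Zhang2022LandauSiegel, §2 (2.22)] -/
private theorem betaMu_six (D : ℕ) : betaMu D 6 = beta6 D := by simp [betaMu]

omit c' in
/-- `conj β₆ = −β₆`. [cite: Zhang2022LandauSiegel, §2 (2.22)] -/
private theorem conj_beta6 (D : ℕ) : conj (beta6 D) = -beta6 D := by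
  rw [beta6]
  simp only [map_div₀, map_mul, Complex.conj_I, Complex.conj_ofReal, map_ofNat]
  ring

omit c' in
/-- For real `q ≥ 0`: `conj (q^{β₆}) = q^{−β₆}` (`β₆ = 3iα/2` of (2.22)). [cite: Zhang2022LandauSiegel, §2 (2.22)] -/
private theorem conj_cpow_beta6 (D : ℕ) {q : ℝ} (hq : 0 ≤ q) :
    conj (((q : ℝ) : ℂ) ^ beta6 D) = ((q : ℝ) : ℂ) ^ (-beta6 D) := by
  have harg : ((q : ℝ) : ℂ).arg ≠ π := by
    rw [Complex.arg_ofReal_of_nonneg hq]; exact Real.pi_pos.ne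
  rw [← conj_beta6, Complex.cpow_conj _ _ harg, Complex.conj_ofReal]

omit c' in
/-- For `𝓛 ≥ 2`: `1 < P`, `P₃ < P`, `P₃ ≤ PT⁻²`, `1 ≤ log P₃`. [cite: Zhang2022LandauSiegel, §2 (2.6), (2.21)] -/
private theorem P3_facts (hD : 2 ≤ Real.log D) :
    1 < bigP D ∧ P3 D < bigP D ∧ P3 D ≤ bigP D / bigT D ^ 2 ∧ 1 ≤ Real.log (P3 D) := by
  have hℓ : 2 ≤ ell D := by rw [ell]; exact hD
  have hP : 1 < bigP D := by
    rw [bigP]; exact Real.one_lt_exp_iff.mpr (by positivity)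
  refine ⟨hP, ?_, (P3_le_P1 D).trans (P1_le_P_div_T_sq D hD), ?_⟩
  · rw [P3]
    conv_rhs => rw [← Real.rpow_one (bigP D)]
    exact Real.rpow_lt_rpow_of_exponent_lt hP (by norm_num)
  · rw [log_P3]
    have : (2:ℝ) ^ 9 ≤ ell D ^ 9 := pow_le_pow_left₀ (by norm_num) hℓ 9
    nlinarith

/-- The summand identity behind "By Lemma 8.2 … with `x = P₃/dr`": for `1 ≤ m < y = P₃/(dr)`,
`χ(m)ϰ₃(drm)m^{−(1−β_j)} = (log P₃)⁻¹ · χ(m)m^{−(1−β_j)}(y/m)^{β₆}log(y/m)`.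
[cite: Zhang2022LandauSiegel, §9 p.51, tex L2606; §8 (8.6) p.44] -/
theorem vk3_summand_eq [NeZero D] (χ : DirichletCharacter ℂ D) (j : ℕ) {d r m : ℕ}
    (hdr : 0 < ((d * r : ℕ) : ℝ)) (hm : 1 ≤ m) (hP3 : Real.log (P3 D) ≠ 0)
    (hmy : (m : ℝ) < P3 D / ((d * r : ℕ) : ℝ)) :
    χ (m : ZMod D) * vk3 D (d * r * m) / (m : ℂ) ^ (1 - betaJ c' D j) =
      (Real.log (P3 D) : ℂ)⁻¹ *
        (χ (m : ZMod D) / (m : ℂ) ^ (1 - betaJ c' D j) *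
          ((P3 D / ((d * r : ℕ) : ℝ) / m : ℝ) : ℂ) ^ betaMu D 6 *
          (Real.log (P3 D / ((d * r : ℕ) : ℝ) / m) : ℂ)) := by
  have hm0 : (0 : ℝ) < m := by exact_mod_cast hm
  have hP3pos : 0 < P3 D := (P2_pos_P3_pos D).2
  have hcast : ((d * r * m : ℕ) : ℝ) = ((d * r : ℕ) : ℝ) * m := by push_cast; ring
  have hlt : ((d * r * m : ℕ) : ℝ) < P3 D := by
    rw [hcast]; rwa [lt_div_iff₀ hdr, mul_comm] at hmy
  have hdrm : 0 < ((d * r * m : ℕ) : ℝ) := by rw [hcast]; positivity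
  have hq : P3 D / ((d * r * m : ℕ) : ℝ) = P3 D / ((d * r : ℕ) : ℝ) / m := by
    rw [hcast, div_div]
  have hlog : 1 - Real.log ((d * r * m : ℕ) : ℝ) / Real.log (P3 D) =
      Real.log (P3 D / ((d * r : ℕ) : ℝ) / m) / Real.log (P3 D) := by
    rw [← hq, Real.log_div hP3pos.ne' hdrm.ne']
    field_simp
  rw [vk3, if_pos hlt, hlog, hq, betaMu_six]
  have hL : (Real.log (P3 D) : ℂ) ≠ 0 := by exact_mod_cast hP3
  push_cast
  field_simp

/-- **`Z22:§9.u002` INFERENCE, DISCHARGED**: `Skeleton.Lemma82 c' → Step9u002 c'` — Lemma 8.2 at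
`x = P₃/(dr)` (`T < x < P` iff `dr < P₃/T`), `μ = 6`, after the summand identity `vk3_summand_eq`
and the truncation of the `m`-sum of `S_j` at `m < x` (the terms `m ≥ x` vanish); the error
`O(𝓛⁻⁶)/log P₃ ≤ O(𝓛⁻⁶)`. [cite: Zhang2022LandauSiegel, §9 p.51, tex L2605–L2608] -/
theorem ded9u002_holds : Ded9u002 c' := by
  rintro ⟨C, hC⟩
  refine ⟨max C 0, ?_⟩
  refine (hC.and (forAllLarge_log_ge 2)).mono ?_
  intro D _ χ _ _ ⟨H82, HL⟩ hA j hj d r hd hr hdr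
  obtain ⟨hP1, hP3P, hP3T, hlog1⟩ := P3_facts (D := D) HL
  have hP3pos : 0 < P3 D := (P2_pos_P3_pos D).2
  have hdr0 : 0 < ((d * r : ℕ) : ℝ) := by
    have : 1 ≤ d * r := Nat.one_le_iff_ne_zero.mpr (Nat.mul_ne_zero (by omega) (by omega))
    exact_mod_cast this
  set y : ℝ := P3 D / ((d * r : ℕ) : ℝ) with hy
  have hTy : bigT D < y := by
    rw [hy, lt_div_iff₀ hdr0, mul_comm]; rwa [lt_div_iff₀ (bigT_pos D)] at hdr
  have hyP3 : y ≤ P3 D := by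
    rw [hy]; refine div_le_self hP3pos.le ?_
    have : 1 ≤ d * r := Nat.one_le_iff_ne_zero.mpr (Nat.mul_ne_zero (by omega) (by omega))
    exact_mod_cast this
  have hyP : y < bigP D := lt_of_le_of_lt hyP3 hP3P
  have key := H82 hA j hj 6 (by simp) y hTy hyP
  have hlogne : Real.log (P3 D) ≠ 0 := by linarith
  -- truncation: the `m`-sum of `S_j` over `Ico 1 (Nsupp D)` equals the sum over `Ico 1 ⌈y⌉₊`
  have hceil : ⌈y⌉₊ ≤ Nsupp D := Nat.ceil_mono (hyP3.trans hP3T)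
  have hsub : Finset.Ico 1 ⌈y⌉₊ ⊆ Finset.Ico 1 (Nsupp D) := Finset.Ico_subset_Ico_right hceil
  have hzero : ∀ m ∈ Finset.Ico 1 (Nsupp D), m ∉ Finset.Ico 1 ⌈y⌉₊ →
      χ (m : ZMod D) * vk3 D (d * r * m) / (m : ℂ) ^ (1 - betaJ c' D j) = 0 := by
    intro m hm hm'
    rw [Finset.mem_Ico] at hm
    rw [Finset.mem_Ico, not_and, not_lt] at hm'
    have hym : y ≤ m := Nat.ceil_le.mp (hm' hm.1)
    have hge : ¬ ((d * r * m : ℕ) : ℝ) < P3 D := by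
      rw [not_lt]
      have e1 : P3 D = y * ((d * r : ℕ) : ℝ) := by rw [hy, div_mul_cancel₀ _ hdr0.ne']
      have e2 : ((d * r * m : ℕ) : ℝ) = (m : ℝ) * ((d * r : ℕ) : ℝ) := by push_cast; ring
      rw [e1, e2]
      exact mul_le_mul_of_nonneg_right hym hdr0.le
    rw [vk3, if_neg hge]; simp
  rw [← Finset.sum_subset hsub hzero]
  -- summand identity
  have hterm : ∀ m ∈ Finset.Ico 1 ⌈y⌉₊,
      χ (m : ZMod D) * vk3 D (d * r * m) / (m : ℂ) ^ (1 - betaJ c' D j) =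
        (Real.log (P3 D) : ℂ)⁻¹ *
          (χ (m : ZMod D) / (m : ℂ) ^ (1 - betaJ c' D j) * ((y / m : ℝ) : ℂ) ^ betaMu D 6 *
            (Real.log (y / m) : ℂ)) := by
    intro m hm
    rw [Finset.mem_Ico] at hm
    have hmy : (m : ℝ) < y := Nat.lt_ceil.mp hm.2
    exact vk3_summand_eq c' χ j hdr0 hm.1 hlogne hmy
  rw [Finset.sum_congr rfl hterm, ← Finset.mul_sum]
  have hL : (Real.log (P3 D) : ℂ) ≠ 0 := by exact_mod_cast hlogne
  have e : (Real.log (P3 D) : ℂ)⁻¹ *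
        (∑ m ∈ Finset.Ico 1 ⌈y⌉₊, χ (m : ZMod D) / (m : ℂ) ^ (1 - betaJ c' D j) *
          ((y / m : ℝ) : ℂ) ^ betaMu D 6 * (Real.log (y / m) : ℂ)) -
        deriv χ.LFunction 1 / (Real.log (P3 D) : ℂ) * frakfW c' D j 6 y =
      (Real.log (P3 D) : ℂ)⁻¹ *
        ((∑ m ∈ Finset.Ico 1 ⌈y⌉₊, χ (m : ZMod D) / (m : ℂ) ^ (1 - betaJ c' D j) *
          ((y / m : ℝ) : ℂ) ^ betaMu D 6 * (Real.log (y / m) : ℂ)) -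
          deriv χ.LFunction 1 * frakfW c' D j 6 y) := by
    field_simp
  rw [e, norm_mul, norm_inv, Complex.norm_real, Real.norm_eq_abs, abs_of_pos (by linarith)]
  calc (Real.log (P3 D))⁻¹ * ‖(∑ m ∈ Finset.Ico 1 ⌈y⌉₊, χ (m : ZMod D) / (m : ℂ) ^ (1 - betaJ c' D j) *
          ((y / m : ℝ) : ℂ) ^ betaMu D 6 * (Real.log (y / m) : ℂ)) - deriv χ.LFunction 1 * frakfW c' D j 6 y‖
      ≤ 1 * (C * (ell D ^ 6)⁻¹) := by
        refine mul_le_mul ?_ key (norm_nonneg _) zero_le_one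
        exact inv_le_one_of_one_le₀ hlog1
    _ ≤ max C 0 * (ell D ^ 6)⁻¹ := by
        rw [one_mul]
        have hℓ : 0 < ell D := by rw [ell]; linarith
        exact mul_le_mul_of_nonneg_right (le_max_left _ _) (by positivity)

/-- `Ded9u002` — `_holds` alias of `ded9u002_holds` above under the fact's exact name (appended
2026-08-28, D-0026 bookkeeping: the proof term is the existing theorem of this file; no statement,
definition or attribute is edited; no new named fact; the ledger's debt table listed the fact
unproved). [cite: Zhang2022LandauSiegel, §9 p.51, tex L2605–L2608] -/
theorem _root_.Literature.NumberTheory.LFunctions.Zhang2022.Section9Statements.Ded9u002_holds :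
    Ded9u002 c' :=
  _root_.Literature.NumberTheory.LFunctions.Zhang2022.Section9Discharge.ded9u002_holds (c' := c')

end LemmaApplications


section LemmaApplications2

variable (c' : ℝ) {D : ℕ}

/-- The summand identity behind "By Lemma … 8.4 with `x = P₃/dr`": for `1 ≤ n < y = P₃/(dr)`,
`χ(n)conj(ϰ₃(drn))ξ₀ⱼ(n;d,r)n⁻¹ = (log P₃)⁻¹ · χ(n)ξ₀ⱼ(n;d,r)n⁻¹(y/n)^{−β₆}log(y/n)` (`conj(q^{β₆}) = q^{−β₆}`
for real `q > 0`). [cite: Zhang2022LandauSiegel, §9 p.51, tex L2610; §8 (8.6) p.44] -/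
theorem conj_vk3_summand_eq [NeZero D] (χ : DirichletCharacter ℂ D) (j : ℕ) {d r n : ℕ}
    (hdr : 0 < ((d * r : ℕ) : ℝ)) (hn : 1 ≤ n) (hP3 : Real.log (P3 D) ≠ 0)
    (hny : (n : ℝ) < P3 D / ((d * r : ℕ) : ℝ)) :
    χ (n : ZMod D) * conj (vk3 D (d * r * n)) * xiZero c' D j n d r / (n : ℂ) =
      (Real.log (P3 D) : ℂ)⁻¹ *
        (χ (n : ZMod D) * xiZero c' D j n d r / (n : ℂ) *
          ((P3 D / ((d * r : ℕ) : ℝ) / n : ℝ) : ℂ) ^ (-betaMu D 6) *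
          (Real.log (P3 D / ((d * r : ℕ) : ℝ) / n) : ℂ)) := by
  have hn0 : (0 : ℝ) < n := by exact_mod_cast hn
  have hP3pos : 0 < P3 D := (P2_pos_P3_pos D).2
  have hcast : ((d * r * n : ℕ) : ℝ) = ((d * r : ℕ) : ℝ) * n := by push_cast; ring
  have hlt : ((d * r * n : ℕ) : ℝ) < P3 D := by
    rw [hcast]; rwa [lt_div_iff₀ hdr, mul_comm] at hny
  have hdrn : 0 < ((d * r * n : ℕ) : ℝ) := by rw [hcast]; positivity
  have hq : P3 D / ((d * r * n : ℕ) : ℝ) = P3 D / ((d * r : ℕ) : ℝ) / n := by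
    rw [hcast, div_div]
  have hq0 : 0 ≤ P3 D / ((d * r : ℕ) : ℝ) / n := by positivity
  have hlog : 1 - Real.log ((d * r * n : ℕ) : ℝ) / Real.log (P3 D) =
      Real.log (P3 D / ((d * r : ℕ) : ℝ) / n) / Real.log (P3 D) := by
    rw [← hq, Real.log_div hP3pos.ne' hdrn.ne']
    field_simp
  rw [vk3, if_pos hlt, hlog, hq, betaMu_six, map_mul, Complex.conj_ofReal, conj_cpow_beta6 D hq0]
  have hL : (Real.log (P3 D) : ℂ) ≠ 0 := by exact_mod_cast hP3
  push_cast
  field_simp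

/-- **`Z22:§9.u003` INFERENCE, DISCHARGED**: `Skeleton.Lemma84 c' → Step9u003 c'` — Lemma 8.4 at
`x = P₃/(dr)`, `μ = 6` (`dr < P₃/T ≤ PT⁻²` gives Lemma 8.4's range hypothesis), after the summand
identity `conj_vk3_summand_eq` and the truncation at `n < x`; error `O(𝓛⁻⁶)/log P₃ ≤ O(𝓛⁻⁶)`.
[cite: Zhang2022LandauSiegel, §9 p.51, tex L2605–L2612] -/
theorem ded9u003_holds : Ded9u003 c' := by
  rintro ⟨C, hC⟩
  refine ⟨max C 0, ?_⟩
  refine (hC.and (forAllLarge_log_ge 2)).mono ?_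
  intro D _ χ _ _ ⟨H84, HL⟩ hA j hj d r hd hr hdr
  obtain ⟨hP1, hP3P, hP3T, hlog1⟩ := P3_facts (D := D) HL
  have hP3pos : 0 < P3 D := (P2_pos_P3_pos D).2
  have hdr1 : 1 ≤ d * r := Nat.one_le_iff_ne_zero.mpr (Nat.mul_ne_zero (by omega) (by omega))
  have hdr0 : 0 < ((d * r : ℕ) : ℝ) := by exact_mod_cast hdr1
  set y : ℝ := P3 D / ((d * r : ℕ) : ℝ) with hy
  have hT1 : 1 ≤ bigT D := by rw [bigT]; exact Real.one_le_exp (Real.rpow_nonneg (by rw [ell]; positivity) _)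
  have hTy : bigT D < y := by
    rw [hy, lt_div_iff₀ hdr0, mul_comm]; rwa [lt_div_iff₀ (bigT_pos D)] at hdr
  have hyP3 : y ≤ P3 D := by
    rw [hy]; exact div_le_self hP3pos.le (by exact_mod_cast hdr1)
  have hyP : y < bigP D := lt_of_le_of_lt hyP3 hP3P
  have hdrPT : ((d * r : ℕ) : ℝ) < bigP D / bigT D ^ 2 := by
    have h1 : P3 D / bigT D ≤ P3 D := div_le_self hP3pos.le hT1
    linarith
  have key := H84 hA j hj 6 (by simp) d r hd hr hdrPT y hTy hyP
  have hlogne : Real.log (P3 D) ≠ 0 := by linarith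
  have hceil : ⌈y⌉₊ ≤ Nsupp D := Nat.ceil_mono (hyP3.trans hP3T)
  have hsub : Finset.Ico 1 ⌈y⌉₊ ⊆ Finset.Ico 1 (Nsupp D) := Finset.Ico_subset_Ico_right hceil
  have hzero : ∀ n ∈ Finset.Ico 1 (Nsupp D), n ∉ Finset.Ico 1 ⌈y⌉₊ →
      χ (n : ZMod D) * conj (vk3 D (d * r * n)) * xiZero c' D j n d r / (n : ℂ) = 0 := by
    intro n hn hn'
    rw [Finset.mem_Ico] at hn
    rw [Finset.mem_Ico, not_and, not_lt] at hn'
    have hyn : y ≤ n := Nat.ceil_le.mp (hn' hn.1)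
    have hge : ¬ ((d * r * n : ℕ) : ℝ) < P3 D := by
      rw [not_lt]
      have e1 : P3 D = y * ((d * r : ℕ) : ℝ) := by rw [hy, div_mul_cancel₀ _ hdr0.ne']
      have e2 : ((d * r * n : ℕ) : ℝ) = (n : ℝ) * ((d * r : ℕ) : ℝ) := by push_cast; ring
      rw [e1, e2]
      exact mul_le_mul_of_nonneg_right hyn hdr0.le
    rw [vk3, if_neg hge]; simp
  rw [← Finset.sum_subset hsub hzero]
  have hterm : ∀ n ∈ Finset.Ico 1 ⌈y⌉₊,
      χ (n : ZMod D) * conj (vk3 D (d * r * n)) * xiZero c' D j n d r / (n : ℂ) =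
        (Real.log (P3 D) : ℂ)⁻¹ *
          (χ (n : ZMod D) * xiZero c' D j n d r / (n : ℂ) * ((y / n : ℝ) : ℂ) ^ (-betaMu D 6) *
            (Real.log (y / n) : ℂ)) := by
    intro n hn
    rw [Finset.mem_Ico] at hn
    exact conj_vk3_summand_eq c' χ j hdr0 hn.1 hlogne (Nat.lt_ceil.mp hn.2)
  rw [Finset.sum_congr rfl hterm, ← Finset.mul_sum]
  have hL : (Real.log (P3 D) : ℂ) ≠ 0 := by exact_mod_cast hlogne
  have e : (Real.log (P3 D) : ℂ)⁻¹ *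
        (∑ n ∈ Finset.Ico 1 ⌈y⌉₊, χ (n : ZMod D) * xiZero c' D j n d r / (n : ℂ) *
          ((y / n : ℝ) : ℂ) ^ (-betaMu D 6) * (Real.log (y / n) : ℂ)) -
        deriv χ.LFunction 1 * PiW χ d r / (Real.log (P3 D) : ℂ) * frakgW c' D j 6 y =
      (Real.log (P3 D) : ℂ)⁻¹ *
        ((∑ n ∈ Finset.Ico 1 ⌈y⌉₊, χ (n : ZMod D) * xiZero c' D j n d r / (n : ℂ) *
          ((y / n : ℝ) : ℂ) ^ (-betaMu D 6) * (Real.log (y / n) : ℂ)) -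
          deriv χ.LFunction 1 * PiW χ d r * frakgW c' D j 6 y) := by
    field_simp
  rw [e, norm_mul, norm_inv, Complex.norm_real, Real.norm_eq_abs, abs_of_pos (by linarith)]
  calc (Real.log (P3 D))⁻¹ * ‖(∑ n ∈ Finset.Ico 1 ⌈y⌉₊, χ (n : ZMod D) * xiZero c' D j n d r / (n : ℂ) *
          ((y / n : ℝ) : ℂ) ^ (-betaMu D 6) * (Real.log (y / n) : ℂ)) -
          deriv χ.LFunction 1 * PiW χ d r * frakgW c' D j 6 y‖
      ≤ 1 * (C * (ell D ^ 6)⁻¹) := by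
        refine mul_le_mul ?_ key (norm_nonneg _) zero_le_one
        exact inv_le_one_of_one_le₀ hlog1
    _ ≤ max C 0 * (ell D ^ 6)⁻¹ := by
        rw [one_mul]
        have hℓ : 0 < ell D := by rw [ell]; linarith
        exact mul_le_mul_of_nonneg_right (le_max_left _ _) (by positivity)

/-- `Ded9u003` — `_holds` alias of `ded9u003_holds` above under the fact's exact name (appended
2026-08-28, D-0026 bookkeeping: the proof term is the existing theorem of this file; no statement,
definition or attribute is edited; no new named fact; the ledger's debt table listed the fact
unproved). [cite: Zhang2022LandauSiegel, §9 p.51, tex L2605–L2612] -/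
theorem _root_.Literature.NumberTheory.LFunctions.Zhang2022.Section9Statements.Ded9u003_holds :
    Ded9u003 c' :=
  _root_.Literature.NumberTheory.LFunctions.Zhang2022.Section9Discharge.ded9u003_holds (c' := c')

end LemmaApplications2

end Literature.NumberTheory.LFunctions.Zhang2022.Section9Discharge

end
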